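import Summits.Langlands.Langlands.Theorems.IrreducibilityBySelfDualityPairLBoundaryJS
import Summits.Langlands.Langlands.Theorems.IrreducibilityBySelfDualityPairLBoundaryJSSsv
import Summits.Langlands.Langlands.Theorems.IrreducibilityBySelfDualityPairLBoundaryJSStandardEntire
import Summits.Langlands.Langlands.Theorems.IrreducibilityBySelfDualityPairLBoundaryJSIsOrthoOfLocalTranslate
import Summits.Langlands.Langlands.Theorems.IrreducibilityBySelfDualityPairLBoundaryJSEqConjOfLocalTranslate
import Summits.Langlands.Langlands.Theorems.IrreducibilityBySelfDualityPairLBoundaryJSLocalPairTranslate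
import Summits.Langlands.Langlands.Theorems.IrreducibilityBySelfDualityPairLBoundaryJSOfHumphriesJo
import Summits.Langlands.Langlands.Theorems.IrreducibilityBySelfDualityPairLBoundaryJSCornerBochnerIwasawa
import Summits.Langlands.Langlands.Theorems.IrreducibilityBySelfDualityPairLBoundaryJSCornerPairTranslate
import Summits.Langlands.Langlands.Theorems.IrreducibilityBySelfDualityPairLBoundaryJSCornerPairEuler
import Summits.Langlands.Langlands.Theorems.IrreducibilityBySelfDualityPairLBoundaryJSCornerAbsMajorant
import Summits.Langlands.Langlands.Theorems.IrreducibilityBySelfDualityPairLBoundaryJSCornerAbsIdeleMoment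
import Summits.Langlands.Langlands.Theorems.IrreducibilityBySelfDualityPairLBoundaryJSCornerAbsTorusMajorant
import Summits.Langlands.Langlands.Theorems.IrreducibilityBySelfDualityPairLBoundaryJSCornerAbsConvergence
import Summits.Langlands.Langlands.Theorems.IrreducibilityBySelfDualityPairLBoundaryJSCornerEulerLimit
import Summits.Langlands.Langlands.Theorems.IrreducibilityBySelfDualityPairLBoundaryJSHonestTranslateUnramified
import Summits.Langlands.Langlands.Theorems.IrreducibilityBySelfDualityPairLBoundaryJSCornerGlobal
import Summits.Langlands.Langlands.Theorems.IrreducibilityBySelfDualityPairLBoundaryJSCornerArchFactorData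
import Summits.Langlands.Langlands.Theorems.IrreducibilityBySelfDualityPairLBoundaryJSCornerGlobalTranslate
import Summits.Langlands.Langlands.Theorems.IrreducibilityBySelfDualityPairLBoundaryJSCornerUnitBoxProductForm
import Summits.Langlands.Langlands.Theorems.IrreducibilityBySelfDualityPairLBoundaryJSCornerLocalSingleDatum
import Summits.Langlands.Langlands.Theorems.IrreducibilityBySelfDualityPairLBoundaryJSCornerLocalControlAsm
import Summits.Langlands.Langlands.Theorems.IrreducibilityBySelfDualityPairLBoundaryJSGapAbsConvergence
import Summits.Langlands.Langlands.Theorems.IrreducibilityBySelfDualityPairLBoundaryJSGapUnitBoxProductForm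
import Summits.Langlands.Langlands.Theorems.IrreducibilityBySelfDualityPairLBoundaryJSGapEulerLimit
import Summits.Langlands.Langlands.Theorems.IrreducibilityBySelfDualityPairLBoundaryJSGapLocalSingleDatum
import Summits.Langlands.Langlands.Theorems.IrreducibilityBySelfDualityPairLBoundaryJSGapLocalControlAsm
import Summits.Langlands.Langlands.Theorems.IrreducibilityBySelfDualityPairLBoundaryJSGapGlobalTranslate
import Literature.NumberTheory.Automorphic.PairLFunctionMeromorphicContinuationRankNeTwistProofs
import Literature.NumberTheory.Automorphic.ArchRankinSelbergCornerTestVector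
import Literature.NumberTheory.Automorphic.ArchRankinSelbergGapTestVector
import Literature.NumberTheory.Automorphic.JPSSUnfoldedPairIntegralEntire
import Literature.NumberTheory.Automorphic.ClozelAlgebraicityComplexConjProofs
import Literature.NumberTheory.Automorphic.AutomorphicConjugate
import Literature.NumberTheory.Automorphic.ArchRankinSelbergTestVector
import Literature.NumberTheory.Automorphic.JPSSGlobalIntegralQuotientUnfolding
import Literature.NumberTheory.Automorphic.JPSSCornerWhittakerUnfolding
import Literature.NumberTheory.Automorphic.WhittakerPeriodExchange
import Literature.NumberTheory.Automorphic.TorusIwasawaTransport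
import Literature.NumberTheory.Automorphic.CornerTorusIwasawaData
import Literature.NumberTheory.Automorphic.WhittakerCoeffHonestCuspForm
import Literature.NumberTheory.Automorphic.WhittakerCoeffTranslateUnramified
import Literature.NumberTheory.Automorphic.WhittakerDecayCuspForm
import Literature.NumberTheory.Automorphic.WhittakerSupportFinite
import Literature.NumberTheory.Automorphic.RankinSelbergUnramifiedTorus
import Literature.NumberTheory.Automorphic.RankinSelbergTorusPairEuler
import Literature.NumberTheory.Automorphic.RankinSelbergTowerFiniteness

/-!
# Line `Sketch` — skeleton v21 for the crux `PairLBoundaryJS` (stmt-Langlands-13622), lead c6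

Composition (unchanged since v1; joint sufficiency kernel-checked, p81600):

  crux ⇐ `PairLBoundaryJS_of_moeglinWaldspurger_of_isOrtho hA hC hB`.

## v21 (lead c6, 2026-08-17T02:1xZ): the PROJECTOR ROAD — the global-analytic named fact REDUCED to two decay estimates

No stub changed (the four sorries below are still exactly the four named facts). New, landed beside the skeleton:
Cogdell's §2.2.1–2.2 for GENERAL `m < n` — the projected integral `I^ℙ = jpssProjIntegral` of
`ℙⁿ_m φ = |det|^{-(n-m-1)/2} Φ_m` (`Literature/…/JPSSProjectedGlobalIntegral.lean`, p136544), its entireness granted the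
decay estimates (D1), (D2) (`GapProjectedAnalytic`, p136785 + p137043), its quotient-to-group unfolding granted (D2)
(`GapProjectedQuotientUnfolding`, p136801 + p137045), the insertion of the expansion of `Φ_m` along `N_m(K)\GL_m(K)`
(`GapProjectedWhittakerUnfolding`, p136596), the generic character along the corner at general corank
(`GapProjectedCornerChar`, p136297), the global projected theorem `I^ℙ(s + (n-m)/2) = C ∫ torusPairIntegrandC …`
(`GapProjectedGlobal`, p136770) and the reduction
`GapEntireFactOfDecay.stub_gap_entire_fact_of_decay : (D1) → (D2) → Cogdell2004_unfoldedPairIntegral_entire n m K`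
(proposal in flight at the time of writing; see the crux NOTES.md). (D1)/(D2) are the shapes of
`exists_bound_corner_scalarExp` / `exists_bound_corner_mul` of `CuspFormCornerDecay` with `Φ := Φ_m ∘ ι`; for `m ≤ n - 2`
they need a QUANTITATIVE reduction theory (successive minima over `K`), the one Literature story this line still lacks
on the global side (the tree's `reductionTheory_gl_holds` is existence-only) — see `## Census` of the lead's NOTES.

## v20 (lead c6, 2026-08-17T01:3xZ): the GAP ROAD IS COMPLETE — every engineering stub has LANDED

Mœglin–Waldspurger (i)(a) for `m + 2 ≤ n` is a theorem of the tree GRANTED the two named facts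
`JacquetShalika1990_archRankinSelbergGap_entireRatio` (archimedean, p133384) and `Cogdell2004_unfoldedPairIntegral_entire`
(global-analytic, p133584): `stub_gap_abs_convergence` (p134397; `GapAbsMajorant` p133377), `stub_gap_euler_limit`
(p134811; `GapPairTranslate` p133314, `GapPairEuler` p134005), `stub_gap_unitBox_productForm` (p134574; `GapUnitBoxLocalValue`
p133470, `GapUnitBoxPeel` p134006), `stub_gap_local_single_datum` (p135055; `…OfProductForm` p134160), `stub_gap_local_control`
(p135084; `GapArchFactorData` p133733) and the lead's `stub_gap_global_translate` (p134974; parts p133366, p134002, p134895) are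
one-line citations below. Remaining sorries: exactly the FOUR named facts `stub_humphriesJo`, `stub_jacquet_corner`,
`stub_gap_arch_fact`, `stub_gap_entire_fact`; the conditional crux is landed as
`Theorems/IrreducibilityBySelfDualityPairLBoundaryJSOfGapRoad.lean` (`PairLBoundaryJSOfGapRoad.stub_PairLBoundaryJS_of_four_facts`).

## v19 (lead c6, 2026-08-17T00:2xZ): the GAP ROAD — `stub_MW_gap` is now DERIVED

`stub_MW_gap` (Mœglin–Waldspurger (i)(a) for `m + 2 ≤ n`, the crux-sized input of v14–v18) is proved in this
skeleton (`partialPairL_entire_of_gap` ← `gap_entire_quotient_of_local_control`) from the `GL_n × GL_m` analogue of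
the corner road (section `GapRoad` below): two NAMED FACTS — `stub_gap_arch_fact` (archimedean `K_∞`-finite
entire-ratio control for `(n, m)`, `m < n`: Jacquet (2009) Thm. 2.1/2.6 + Prop. 12.5, Cogdell (2004) §4.2) and
`stub_gap_entire_fact` (the analytic clause of Cogdell (2004) Thm. 2.1: entire continuation of the unfolded torus
integral; shown NOT provable from the tree's existence-only reduction theory, see its docstring) — and six
engineering stubs: `stub_gap_abs_convergence`, `stub_gap_euler_limit`, `stub_gap_unitBox_productForm`,
`stub_gap_local_single_datum`, `stub_gap_local_control` (workers) and `stub_gap_global_translate` (lead).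
Remaining sorries: `stub_humphriesJo`, `stub_jacquet_corner`, the two gap facts, the six gap stubs.

## v18 (lead c5, 2026-08-16T23:20Z): the CORNER ROAD IS COMPLETE — every engineering stub has LANDED

Composition (unchanged since v1; joint sufficiency kernel-checked, p81600):

  crux ⇐ `PairLBoundaryJS_of_moeglinWaldspurger_of_isOrtho hA hC hB`.

## v18 (lead c5, 2026-08-16T23:20Z): the CORNER ROAD IS COMPLETE — every engineering stub has LANDED

Mœglin–Waldspurger (i)(a) at `n = m + 1` (and `m = n + 1`) is a theorem of the tree GRANTED ONLY the archimedean
named fact `JacquetArchimedeanRS2009_archRankinSelbergCorner_testVector` (Jacquet (2009), Thm. 2.7 (i)): the corner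
heart `stub_corner_entire_quotient` is PROVED here (`corner_entire_quotient_of_local_control`) from
`corner_global_translate` (`CornerGlobalTranslate`, p130330 + p130043), `corner_local_control`
(`CornerLocalControlAsm`, p131085, assembled from `CornerArchFactorData` p129558 and `CornerLocalSingleDatum` p130763,
the latter on the corner unit-box product form `CornerUnitBoxProductForm` p130375 + p129774 + p130020) and
`stub_jacquet_corner` (Literature p128621). The line's skeleton is now conditional on exactly THREE printed inputs:
`stub_MW_gap` (MW (i)(a) for `m + 2 ≤ n`; crux-sized, promote — memo `promote-MW_gap.md`), `stub_humphriesJo`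
(equal-rank archimedean fact) and `stub_jacquet_corner` (corner archimedean fact); the conditional theorem is landed as
`Theorems/IrreducibilityBySelfDualityPairLBoundaryJSOfCornerRoad.lean`
(`PairLBoundaryJSOfCornerRoad.stub_PairLBoundaryJS_of_gap_of_humphriesJo_of_jacquet`).

Registry note: stub signatures are stored let-free and below ~3900 characters; longer statements are not registrable
(register parts, or the consumer statement).

## State inherited from v14/v15 (leads c4/c5)

c4 landed `CornerBochnerIwasawa.stub_bochner_iwasawa` (p123961), `CornerPairTranslate.stub_corner_translate`
(p125056), `CornerPairEuler.stub_corner_euler` (p125499), `CornerAbsMajorant.stub_corner_majorant` (p126873),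
`CornerAbsIdeleMoment.stub_corner_idele_moment` (p126910); c5 wave 1 landed `CornerAbsTorusMajorant` (p128064),
`CornerAbsConvergence` (p128321), `CornerEulerLimit` (p128318), `HonestTranslateUnramified` (p128330) — all
imported; the corresponding theorems below are one-line citations.
-/

noncomputable section

-- `Summit.Langlands.Langlands.…` (summit = sub-problem name, D-0017 layout) trips `dupNamespace`
set_option linter.dupNamespace false

open scoped MatrixGroups Topology Pointwise ENNReal NNReal ComplexConjugate InnerProductSpace ContDiff
-- the place subtypes indexing `mixedSpace K` are `Fintype` classically (`NormedCommRing (mixedSpace K)`)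
open scoped Classical Matrix.Norms.Operator
open NumberField IsDedekindDomain MeasureTheory Measure Matrix Set Filter WithZero
open NumberField.mixedEmbedding
open Literature.NumberTheory.Automorphic AdelicGroupData
open Literature.NumberTheory.GaloisRepresentations (ideleGroup HeckeCharacter)
open Literature.MeasureTheory.Group
open Literature.RingTheory.SymmetricFunctions.SymmPoly
open ValuativeRel

-- the automorphic quotient carries the tree's Borel σ-algebra, not Mathlib's quotient σ-algebra
attribute [-instance] Quotient.instMeasurableSpace QuotientGroup.measurableSpace

-- the house local instances, exactly as in `RankinSelbergUnfoldingIdentity`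
attribute [local instance] adelicBorel borelSpace_adelic locallyCompactSpace_adelic secondCountableTopology_gl_adelic
  glAdeleBorel borelSpace_glAdele borelSpace_ideleGroup secondCountableTopology_ideleGroup

-- Mathlib idiom: the commutator Lie ring on matrices, to mention `(archGroupGL n K).lie`
attribute [local instance 100] LieRing.ofAssociativeRing

namespace Summit.Langlands.Langlands.Theorems

/-! ## Registered stubs -/

/-- **STUB (named fact, XL) — Humphries–Jo (2024) Thm. 1.1 / Thm. 5.6 with Jacquet–Shalika's archimedean
convergence**: the Literature fact `HumphriesJo2024_archRankinSelberg_testVector`. -/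
theorem stub_humphriesJo :
    ∀ (n : ℕ) (K : Type) [Field K] [NumberField K], HumphriesJo2024_archRankinSelberg_testVector n K := by
  sorry

/-- **W-Iw (LANDED p123961)** — the Iwasawa evaluation in torus coordinates for a complex
`N_n(𝔸_K)`-invariant integrand: `CornerBochnerIwasawa.stub_bochner_iwasawa`. [folklore] -/
theorem bochner_iwasawa :
    ∀ {n : ℕ} {K : Type} [Field K] [NumberField K]
      [MeasurableSpace (AdeleRing (𝓞 K) K)] [BorelSpace (AdeleRing (𝓞 K) K)] (_hn : 0 < n)
      (ν : Measure (GL (Fin n) (AdeleRing (𝓞 K) K))) [ν.IsHaarMeasure]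
      (νA : Measure (Fin n → ideleGroup K)) [IsHaarMeasure νA]
      (νK : Measure ↥(maximalCompactAdelic n K)) [IsHaarMeasure νK],
      ∃ C : ℝ, 0 < C ∧
        ∀ {F : GL (Fin n) (AdeleRing (𝓞 K) K) → ℂ}, Measurable F →
          (∀ u : GL (Fin n) (AdeleRing (𝓞 K) K), u ∈ adelicColRange n K 1 (n - 1) → ∀ x, F (u * x) = F x) →
        ∀ (s : ℂ) {β : GL (Fin n) (AdeleRing (𝓞 K) K) → ℝ≥0∞}, Measurable β →
          (∀ x, coveringSum ↥(ratPoints (tailUnipotent n K 0)) β x = 1) →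
          Integrable (fun x => F x *
            ((((IdeleClassGroup.ideleNorm K (Matrix.GeneralLinearGroup.det x) : ℝ≥0) : ℝ) : ℂ)) ^ s *
            ((β x).toReal : ℂ)) ν →
          Integrable (fun p => F (torusPoint n K p) * torusWeightC n K s p.1) (νA.prod νK) ∧
          ∫ x, F x * ((((IdeleClassGroup.ideleNorm K (Matrix.GeneralLinearGroup.det x) : ℝ≥0) : ℝ) : ℂ)) ^ s *
              ((β x).toReal : ℂ) ∂ν =
            (C : ℂ) * ∫ p, F (torusPoint n K p) * torusWeightC n K s p.1 ∂(νA.prod νK) :=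
  CornerBochnerIwasawa.stub_bochner_iwasawa

/-- **W-Eu (LANDED p125499)** — the exact Euler factorisation of the unfolded `GL_{m+1} × GL_m` corner
integral over a finite set of good places: `CornerPairEuler.stub_corner_euler`. [folklore] -/
theorem corner_euler :
    ∀ {m : ℕ} {K : Type} [Field K] [NumberField K]
      [MeasurableSpace (AdeleRing (𝓞 K) K)] [BorelSpace (AdeleRing (𝓞 K) K)] (_hm : 0 < m)
      (νA : Measure (Fin m → ideleGroup K)) [IsHaarMeasure νA]
      (νK : Measure ↥(maximalCompactAdelic m K)) [IsHaarMeasure νK]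
      {W : GL (Fin (m + 1)) (AdeleRing (𝓞 K) K) → ℂ} {W' : GL (Fin m) (AdeleRing (𝓞 K) K) → ℂ},
      Continuous W → Continuous W' →
      (∀ (z : ideleGroup K) (g : GL (Fin (m + 1)) (AdeleRing (𝓞 K) K)),
        ‖W (Matrix.GeneralLinearGroup.scalar (Fin (m + 1)) z * g)‖ = ‖W g‖) →
      ∀ (F : Finset (HeightOneSpectrum (𝓞 K)))
        {ϖ : ∀ v : HeightOneSpectrum (𝓞 K), (v.adicCompletion K)ˣ}
        {x : HeightOneSpectrum (𝓞 K) → Fin (m + 1) → ℂ} {y : HeightOneSpectrum (𝓞 K) → Fin m → ℂ},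
      (∀ v ∈ F, IsTorusUnramifiedAt (m + 1) K W v (ϖ v) (x v)) →
      (∀ v ∈ F, IsTorusUnramifiedAt m K W' v (ϖ v) (y v)) →
      (∀ v ∈ F, ∀ i, ‖x v i‖ ≤ (v.residueCard : ℝ) ^ (1 / 2 : ℝ)) →
      (∀ v ∈ F, ∀ a, ‖y v a‖ ≤ (v.residueCard : ℝ) ^ (1 / 2 : ℝ)) →
      ∀ (s : ℂ), 1 / 2 < s.re →
      Integrable (torusPairIntegrandC m K
        (fun g => W (glCorner (AdeleRing (𝓞 K) K) (Nat.le_succ m) g)) W' (fun _ => (1 : ℝ)) s) (νA.prod νK) →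
      (∏ v ∈ F, ((satakePairPolynomial ((Finset.univ : Finset (Fin (m + 1))).val.map (x v))
          ((Finset.univ : Finset (Fin m)).val.map (y v))).eval
            ((v.residueCard : ℂ) ^ (-(s + 1 / 2))))⁻¹) *
        ∫ p in unitBox (↑F : Set (HeightOneSpectrum (𝓞 K))) ×ˢ Set.univ, torusPairIntegrandC m K
          (fun g => W (glCorner (AdeleRing (𝓞 K) K) (Nat.le_succ m) g)) W' (fun _ => (1 : ℝ)) s p
          ∂(νA.prod νK) =
      ∫ p, torusPairIntegrandC m K
          (fun g => W (glCorner (AdeleRing (𝓞 K) K) (Nat.le_succ m) g)) W' (fun _ => (1 : ℝ)) s p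
          ∂(νA.prod νK) :=
  CornerPairEuler.stub_corner_euler

/-- **W-Ac 3/4 (LANDED p128064, `CornerAbsTorusMajorant.stub_corner_torus_majorant`) — the torus integral of the corner majorant is finite for
`σ ≥ m + 1`**: for a Haar measure `νA` on `(𝔸_Kˣ)ᵐ`, a finite set `S` of finite places, bounds `R_v ≥ 1`
equal to `1` off `S`, `σ ≥ m + 1`, `E ≥ σ + m` and `M ≥ [K:ℚ]E + dim_ℝ K_∞ + 1`:
`∫ 𝟙{|a_{l,v}|_v ≤ R_v} (∏_l ∏_w min(1, ‖a_{l,w}‖^{-M})) |det a|^σ δ_B(a)⁻¹ dνA(a) < ∞` (Euler bound over the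
good places `TorusUnitBoxEulerBound` / `TorusGeometricEulerBound`; on the unit box `B(Sᶜ)` the integrand is a
product over the coordinates and `νA` is a multiple of the product Haar measure, each factor finite by
`CornerAbsIdeleMoment.stub_corner_idele_moment`). [folklore] -/
theorem corner_torus_majorant :
    ∀ {m : ℕ} {K : Type} [Field K] [NumberField K]
      [MeasurableSpace (AdeleRing (𝓞 K) K)] [BorelSpace (AdeleRing (𝓞 K) K)]
      (νA : Measure (Fin m → ideleGroup K)) [IsHaarMeasure νA]
      (S : Finset (HeightOneSpectrum (𝓞 K))) {R : HeightOneSpectrum (𝓞 K) → WithZero (Multiplicative ℤ)},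
      (∀ v, 1 ≤ R v) → (∀ v ∉ S, R v = 1) →
      ∀ {σ : ℝ}, (m : ℝ) + 1 ≤ σ → ∀ {E M : ℕ}, σ + m ≤ E →
      Module.finrank ℚ K * E + Module.finrank ℝ (mixedSpace K) + 1 ≤ M →
      ∫⁻ a, (if ∀ (l : Fin m) (v : HeightOneSpectrum (𝓞 K)),
              Valued.v (((a l : ideleGroup K) : AdeleRing (𝓞 K) K).2 v) ≤ R v then 1 else 0) *
          ENNReal.ofReal (∏ l : Fin m, ∏ w : InfinitePlace K,
            ((max 1 ‖((a l : ideleGroup K) : AdeleRing (𝓞 K) K).1 w‖) ^ M)⁻¹) *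
          ENNReal.ofReal (torusWeight m K σ a) ∂νA < ⊤ :=
  CornerAbsTorusMajorant.stub_corner_torus_majorant

/-- **W-Ac 4/4 (LANDED p128321, `CornerAbsConvergence.stub_corner_abs_convergence_one_of_torus_majorant`) — the one-factor absolute convergence FROM the torus majorant**: the implication
`stub_corner_torus_majorant → (W-Ac-one)`, by the corner majorant of `W_φ`
(`CornerAbsMajorant.stub_corner_majorant`, landed p126873: support `|a_{l,v}|_v ≤ R_v` and the bound
`‖W_φ(ι(diag(a)k))‖ ≤ C ∏_l ∏_w min(1, ‖a_{l,w}‖^{-M})` for every `M`), monotonicity of the lintegral and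
`νK(K) < ∞`. [folklore] -/
theorem corner_abs_convergence_one_of_torus_majorant :
    (∀ {m : ℕ} {K : Type} [Field K] [NumberField K]
      [MeasurableSpace (AdeleRing (𝓞 K) K)] [BorelSpace (AdeleRing (𝓞 K) K)]
      (νA : Measure (Fin m → ideleGroup K)) [IsHaarMeasure νA]
      (S : Finset (HeightOneSpectrum (𝓞 K))) {R : HeightOneSpectrum (𝓞 K) → WithZero (Multiplicative ℤ)},
      (∀ v, 1 ≤ R v) → (∀ v ∉ S, R v = 1) →
      ∀ {σ : ℝ}, (m : ℝ) + 1 ≤ σ → ∀ {E M : ℕ}, σ + m ≤ E →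
      Module.finrank ℚ K * E + Module.finrank ℝ (mixedSpace K) + 1 ≤ M →
      ∫⁻ a, (if ∀ (l : Fin m) (v : HeightOneSpectrum (𝓞 K)),
              Valued.v (((a l : ideleGroup K) : AdeleRing (𝓞 K) K).2 v) ≤ R v then 1 else 0) *
          ENNReal.ofReal (∏ l : Fin m, ∏ w : InfinitePlace K,
            ((max 1 ‖((a l : ideleGroup K) : AdeleRing (𝓞 K) K).1 w‖) ^ M)⁻¹) *
          ENNReal.ofReal (torusWeight m K σ a) ∂νA < ⊤) →
    ∀ {m : ℕ} {K : Type} [Field K] [NumberField K]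
      [MeasurableSpace (AdeleRing (𝓞 K) K)] [BorelSpace (AdeleRing (𝓞 K) K)] (_hm : 0 < m)
      (νA : Measure (Fin m → ideleGroup K)) [IsHaarMeasure νA]
      (νK : Measure ↥(maximalCompactAdelic m K)) [IsHaarMeasure νK]
      {φ : GL (Fin (m + 1)) (AdeleRing (𝓞 K) K) → ℂ},
      IsCuspFormGL (m + 1) K (isCompact_glFiniteIntegralLevel_holds (m + 1) K) φ →
      (∀ z ∈ (AdelicGroupData.gl (m + 1) K).center', ∀ g : (AdelicGroupData.gl (m + 1) K).Adelic, φ (z * g) = φ g) →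
      ∃ σ₀ : ℝ, ∀ σ : ℝ, σ₀ ≤ σ →
        ∫⁻ p, ‖whittakerDepth 0 φ (glCorner (AdeleRing (𝓞 K) K) (Nat.le_succ m) (torusPoint m K p))‖ₑ *
            ENNReal.ofReal (torusWeight m K σ p.1) ∂(νA.prod νK) < ⊤ :=
  CornerAbsConvergence.stub_corner_abs_convergence_one_of_torus_majorant

/-- **W-Ac-one — absolute convergence of the unfolded corner integral, ONE-FACTOR form** (Cogdell (2004),
§2.3 "converges for `Re s ≫ 0` by the gauge estimates"; JPSS (1983), §2): for an `A_G`-invariant honest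
cusp form `φ` on `GL_{m+1}(𝔸_K)` (`0 < m`) there is `σ₀` such that for all `σ ≥ σ₀` the real torus integral
`∫_{(𝔸ˣ)ᵐ × K} |W_φ(diag(diag(a)k,1))| |det a|^σ δ_B(a)⁻¹ < ∞` (`W = whittakerDepth 0`). The second Whittaker
function of the corner integrand being bounded, this is all the unfolding needs. DERIVED from the two stubs
above. [folklore] -/
theorem corner_abs_convergence_one :
    ∀ {m : ℕ} {K : Type} [Field K] [NumberField K]
      [MeasurableSpace (AdeleRing (𝓞 K) K)] [BorelSpace (AdeleRing (𝓞 K) K)] (_hm : 0 < m)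
      (νA : Measure (Fin m → ideleGroup K)) [IsHaarMeasure νA]
      (νK : Measure ↥(maximalCompactAdelic m K)) [IsHaarMeasure νK]
      {φ : GL (Fin (m + 1)) (AdeleRing (𝓞 K) K) → ℂ},
      IsCuspFormGL (m + 1) K (isCompact_glFiniteIntegralLevel_holds (m + 1) K) φ →
      (∀ z ∈ (AdelicGroupData.gl (m + 1) K).center', ∀ g : (AdelicGroupData.gl (m + 1) K).Adelic, φ (z * g) = φ g) →
      ∃ σ₀ : ℝ, ∀ σ : ℝ, σ₀ ≤ σ →
        ∫⁻ p, ‖whittakerDepth 0 φ (glCorner (AdeleRing (𝓞 K) K) (Nat.le_succ m) (torusPoint m K p))‖ₑ *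
            ENNReal.ofReal (torusWeight m K σ p.1) ∂(νA.prod νK) < ⊤ :=
  corner_abs_convergence_one_of_torus_majorant corner_torus_majorant

/-- **W-G (LANDED p129181, `CornerGlobal.stub_corner_global`; parametrised `CornerGlobal.jpssIntegral_eq_mul_integral_torusPairIntegrandC`) — the GLOBAL corner theorem: the `GL_{m+1} × GL_m` integral unfolded to the torus**
(Cogdell (2004), §2.2–2.3, Thm. 2.1 (Eulerian clause, proof: "since `φ` is left invariant … we may unfold";
"integrate first over `N(K)\N(𝔸)`"; the Iwasawa decomposition); JPSS (1983), §2). For `0 < m`, an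
automorphic measure `μ'` on `X_m`, Haar measures `νA`, `νK` on the torus coordinates, there is `C > 0`
such that for all honest cusp forms `φ` on `X_{m+1}`, `φ'` on `X_m` (`IsCuspFormGL` of their classical
functions `Φ = invQuot φ`, `Φ' = invQuot φ'`) and every `s` at which the one-factor torus integral of
`|W_Φ ∘ ι|` at `re s - 1/2` is finite,

  `jpssIntegral (m < m+1) μ' φ φ' s = C · ∫_{(𝔸ˣ)ᵐ × K} W_Φ(ι(ak)) · conj (W_{Φ̄'}(ak)) · |det a|^{s-1/2} δ_B(a)⁻¹`

(`W = whittakerDepth 0`, Tate's character; `ι = glCorner`; the right side is the Bochner pair integral of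
`torusPairIntegrandC m K (W_Φ ∘ ι) (conj ∘ W_{Φ̄'}) 1 (s - 1/2)`). Assembly of the tree's proved bricks
`exists_jpssIntegral_eq_mul_integral_coveringWeight` (quotient → group, `GL_m(K)`-covering weight),
`integral_whittakerDepth_glCorner_mul_eq` (Fourier–Whittaker expansion along the corner),
`integral_mul_mul_toReal_eq_integral_mul_conj_whittakerDepth` (`Φ' ↦ conj W_{Φ̄'}`),
`CornerBochnerIwasawa.stub_bochner_iwasawa` (group → torus) and the lintegral Iwasawa evaluation of
`TorusIwasawaTransport` (to verify the bricks' finiteness hypotheses from the torus hypothesis, `Φ'` and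
`W_{Φ̄'}` being bounded). -/
theorem corner_global :
    ∀ {m : ℕ} {K : Type} [Field K] [NumberField K]
      [MeasurableSpace (AdeleRing (𝓞 K) K)] [BorelSpace (AdeleRing (𝓞 K) K)] (_hm : 0 < m)
      (μ' : Measure (AdelicGroupData.gl m K).automorphicQuotient) [(AdelicGroupData.gl m K).IsAutomorphicMeasure μ']
      (νA : Measure (Fin m → ideleGroup K)) [IsHaarMeasure νA]
      (νK : Measure ↥(maximalCompactAdelic m K)) [IsHaarMeasure νK],
      ∃ C : ℝ, 0 < C ∧
        ∀ {φ : (AdelicGroupData.gl (m + 1) K).automorphicQuotient → ℂ},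
          IsCuspFormGL (m + 1) K (isCompact_glFiniteIntegralLevel_holds (m + 1) K)
            (invQuot (AdelicGroupData.gl (m + 1) K) φ) →
        ∀ {φ' : (AdelicGroupData.gl m K).automorphicQuotient → ℂ},
          IsCuspFormGL m K (isCompact_glFiniteIntegralLevel_holds m K) (invQuot (AdelicGroupData.gl m K) φ') →
        ∀ (s : ℂ),
          ∫⁻ p, ‖whittakerDepth 0 (invQuot (AdelicGroupData.gl (m + 1) K) φ)
                (glCorner (AdeleRing (𝓞 K) K) (Nat.le_succ m) (torusPoint m K p))‖ₑ *
              ENNReal.ofReal (torusWeight m K (s.re - 1 / 2) p.1) ∂(νA.prod νK) < ⊤ →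
          jpssIntegral (Nat.lt_succ_self m) μ' φ φ' s =
            (C : ℂ) * ∫ p, torusPairIntegrandC m K
              (fun g => whittakerDepth 0 (invQuot (AdelicGroupData.gl (m + 1) K) φ)
                (glCorner (AdeleRing (𝓞 K) K) (Nat.le_succ m) g))
              (fun g => conj (whittakerDepth 0 (fun x => conj (invQuot (AdelicGroupData.gl m K) φ' x)) g))
              (fun _ => (1 : ℝ)) (s - 1 / 2) p ∂(νA.prod νK) :=
  CornerGlobal.stub_corner_global

/-- **W-EL (LANDED p128318, `CornerEulerLimit.stub_corner_euler_limit`) — the Euler factorisation of the unfolded corner integral over ALL good places**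
(Jacquet–Shalika (1981), §2 Prop. (2.3), §4; Cogdell (2004), Thm. 2.2 with Thm. 3.3): the corner analogue
of `rankinSelbergTorusPairIntegralC_eq_mul_setIntegral_of_hasProd`. For continuous `W` on
`GL_{m+1}(𝔸_K)` (`‖W‖` central-invariant) and `W'` on `GL_m(𝔸_K)`, unramified Whittaker–Hecke torus
data at every `v ∉ S'` with parameters `x_v`, `y_v` bounded by `q_v^{1/2}` and enumerating `α_v`, `β_v`,
an integrable corner pair integrand `I_s` (`re s > 1/2`), and `L` the product of the local factors
`P_{α_v, β_v}(q_v^{-(s+1/2)})⁻¹` over `v ∉ S'`: `∫ I_s = L · ∫_{B({v ∉ S'}) × K} I_s` (from the landed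
finite factorisation `CornerPairEuler.stub_corner_euler` along the finite subsets of `{v ∉ S'}` and
`tendsto_setIntegral_unitBox_image_pair`). -/
theorem corner_euler_limit :
    ∀ {m : ℕ} {K : Type} [Field K] [NumberField K]
      [MeasurableSpace (AdeleRing (𝓞 K) K)] [BorelSpace (AdeleRing (𝓞 K) K)] (_hm : 0 < m)
      (νA : Measure (Fin m → ideleGroup K)) [IsHaarMeasure νA]
      (νK : Measure ↥(maximalCompactAdelic m K)) [IsHaarMeasure νK]
      {W : GL (Fin (m + 1)) (AdeleRing (𝓞 K) K) → ℂ} {W' : GL (Fin m) (AdeleRing (𝓞 K) K) → ℂ},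
      Continuous W → Continuous W' →
      (∀ (z : ideleGroup K) (g : GL (Fin (m + 1)) (AdeleRing (𝓞 K) K)),
        ‖W (Matrix.GeneralLinearGroup.scalar (Fin (m + 1)) z * g)‖ = ‖W g‖) →
      ∀ {S' : Set (HeightOneSpectrum (𝓞 K))}
        {ϖ : ∀ v : HeightOneSpectrum (𝓞 K), (v.adicCompletion K)ˣ}
        {x : HeightOneSpectrum (𝓞 K) → Fin (m + 1) → ℂ} {y : HeightOneSpectrum (𝓞 K) → Fin m → ℂ},
      (∀ v ∉ S', IsTorusUnramifiedAt (m + 1) K W v (ϖ v) (x v)) →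
      (∀ v ∉ S', IsTorusUnramifiedAt m K W' v (ϖ v) (y v)) →
      (∀ v ∉ S', ∀ i, ‖x v i‖ ≤ (v.residueCard : ℝ) ^ (1 / 2 : ℝ)) →
      (∀ v ∉ S', ∀ a, ‖y v a‖ ≤ (v.residueCard : ℝ) ^ (1 / 2 : ℝ)) →
      ∀ (s : ℂ), 1 / 2 < s.re →
      Integrable (torusPairIntegrandC m K
        (fun g => W (glCorner (AdeleRing (𝓞 K) K) (Nat.le_succ m) g)) W' (fun _ => (1 : ℝ)) s) (νA.prod νK) →
      ∀ {α β : HeightOneSpectrum (𝓞 K) → Multiset ℂ},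
      (∀ v ∉ S', (Finset.univ : Finset (Fin (m + 1))).val.map (x v) = α v) →
      (∀ v ∉ S', (Finset.univ : Finset (Fin m)).val.map (y v) = β v) →
      ∀ {L : ℂ}, HasProd (fun u : {v : HeightOneSpectrum (𝓞 K) // v ∉ S'} =>
        ((satakePairPolynomial (α u.1) (β u.1)).eval ((u.1.residueCard : ℂ) ^ (-(s + 1 / 2))))⁻¹) L →
      ∫ p, torusPairIntegrandC m K (fun g => W (glCorner (AdeleRing (𝓞 K) K) (Nat.le_succ m) g)) W'
          (fun _ => (1 : ℝ)) s p ∂(νA.prod νK) =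
        L * ∫ p in unitBox {v | v ∉ S'} ×ˢ Set.univ, torusPairIntegrandC m K
          (fun g => W (glCorner (AdeleRing (𝓞 K) K) (Nat.le_succ m) g)) W' (fun _ => (1 : ℝ)) s p
          ∂(νA.prod νK) :=
  CornerEulerLimit.stub_corner_euler_limit

/-- **W-Tr (LANDED p128330, `HonestTranslateUnramified.stub_honest_translate_unramified`; reshaped v15: the Haar-type instance hypotheses on `ν` of the tree's
`exists_isTorusUnramifiedAt_whittakerCoeff_of_ae_eq` / `…_smoothedForm_translate` are now in the signature; the
v14 form quantified over an ARBITRARY measure `ν` and was not provable) — the translated Whittaker coefficient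
of an HONEST cusp form is an unramified torus datum at a good place of any conductor** (the honest-form version of
`exists_isTorusUnramifiedAt_whittakerCoeff_smoothedForm_translate`, by the pointwise Hecke equations
`sum_invQuot_mul_ofLocal_rep_eq_of_ae_eq` of `WhittakerCoeffHonestCuspForm`; Cogdell (2004), §3.1, Thm. 3.3
"translating the essential vector"; Shintani (1976)). -/
theorem honest_translate_unramified :
    ∀ {n : ℕ} {K : Type} [Field K] [NumberField K]
      {μ : Measure (AdelicGroupData.gl n K).automorphicQuotient} [(AdelicGroupData.gl n K).IsAutomorphicMeasure μ]
      [MeasurableSpace ↥(adelicUnipotent n K)] [BorelSpace ↥(adelicUnipotent n K)]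
      [MeasurableConstSMul ↥(rationalUnipotent n K) ↥(adelicUnipotent n K)]
      {ν : Measure ↥(adelicUnipotent n K)} [IsFiniteMeasureOnCompacts ν]
      [SMulInvariantMeasure ↥(rationalUnipotent n K) ↥(adelicUnipotent n K) ν] [ν.IsMulRightInvariant]
      {𝓕 : Set ↥(adelicUnipotent n K)} {ψ : AddChar (AdeleRing (𝓞 K) K) Circle}
      (P : CuspidalAutomorphicRepGL n K μ)
      {S : Set (HeightOneSpectrum (𝓞 K))} {α : SatakeFamily K}, IsSatakeFamilyOf P S α →
      ∀ {𝔫₀ : Ideal (𝓞 K)}, 𝔫₀ ≠ 0 → ∀ {v : HeightOneSpectrum (𝓞 K)}, v ∉ S → ¬ v.asIdeal ∣ 𝔫₀ →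
      ∀ {Φ : (AdelicGroupData.gl n K).automorphicQuotient → ℂ}, Continuous Φ →
      ∀ (sv : P.1.toSubmodule),
      (((sv : (AdelicGroupData.gl n K).L2 μ) : (AdelicGroupData.gl n K).automorphicQuotient → ℂ) =ᵐ[μ] Φ) →
      (∀ k ∈ principalCongruenceLevel n K 𝔫₀, ∀ y : GL (Fin n) (AdeleRing (𝓞 K) K),
        invQuot (AdelicGroupData.gl n K) Φ (y * k) = invQuot (AdelicGroupData.gl n K) Φ y) →
      ∀ {x : Fin n → ℂ}, (Finset.univ : Finset (Fin n)).val.map x = α v →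
      IsFundamentalDomain ↥(rationalUnipotent n K) 𝓕 ν → IsCompact (closure 𝓕) → IsGlobalAddChar K ψ →
      ∀ {T : GL (Fin n) (AdeleRing (𝓞 K) K)} {d : Fin n → (v.adicCompletion K)ˣ} {a : (v.adicCompletion K)ˣ},
      localComponent v T = diagonalGL (Fin n) (v.adicCompletion K) d →
      (∀ i j : Fin n, (i : ℕ) + 1 = j → (d i : v.adicCompletion K) * ((d j)⁻¹ : (v.adicCompletion K)ˣ) = a) →
      (∀ c ∈ 𝒪[v.adicCompletion K], ψ.adicComponent v (a * c) = 1) →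
      (∀ ϖ : v.adicCompletion K, Valued.v ϖ = WithZero.exp (-1 : ℤ) →
        ∃ c ∈ 𝒪[v.adicCompletion K], ψ.adicComponent v (a * (ϖ⁻¹ * c)) ≠ 1) →
      ∃ ϖ : (v.adicCompletion K)ˣ, IsTorusUnramifiedAt n K
        (fun g => whittakerCoeff ν 𝓕 ψ (invQuot (AdelicGroupData.gl n K) Φ) (T * g)) v ϖ x :=
  HonestTranslateUnramified.stub_honest_translate_unramified

/-- **W-CGT (LANDED p130330, `CornerGlobalTranslate.stub_corner_global_translate`; part 1 p130043 `CornerGlobalTranslatePart1.stub_corner_integral_translate`) — the corner global theorem in TRANSLATE form: `I(s; Φ, Φ̄') = C · w_{s-1/2}(τ) ·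
L^{S'}(s, α ⊗ γ̄) · Ψ^τ_{S'}(s - 1/2)` on a right half-plane** (Cogdell (2004), Thm. 2.1–2.2 (Eulerian
clause), §3.1 "translate the essential vector", Thm. 3.3, §4.2; Jacquet–Piatetski-Shapiro–Shalika (1983),
§2; the corner analogue of `GlobalPairTranslateGen.stub_global_pair_translate_gen`). There is `C > 0`
(Haar measures) such that for cuspidal `π` on `GL_{m+1}(𝔸_K)`, `σ` on `GL_m(𝔸_K)` (`0 < m`) with Satake
families `α`, `γ` off `S`, HONEST continuous representatives `Φ`, `Φ'` (`IsCuspFormGL` of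
`invQuot Φ`, `invQuot Φ'`) of vectors `sv ∈ π`, `sv' ∈ σ`, right `K(𝔫₀)`-invariant (`𝔫₀ ≠ 0`), every
`S' ⊇ S` off which `v ∤ 𝔫₀`, every torus element `τ ∈ (𝔸_Kˣ)ᵐ` whose extension `(τ, 1)` realises at
every `v ∉ S'` a diagonal shift of constant ratio `a_v` with `ψ_{K,v}(a_v ·)` of conductor `𝒪_v`, and all
enumerations `x`, `y` of `α`, `γ` off `S'`, there is `x₀` with, for `re s > x₀`,
`jpssIntegral (m < m+1) μ' Φ (star Φ') s = C · torusWeightC m K (s - 1/2) τ · partialPairL S' α γ̄ s ·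
∫_{B({v ∉ S'}) × K} torusPairIntegrandC m K (W_Φ(diag(τ,1) ι ·)) (star W_{Φ'}(diag τ ·)) 1 (s - 1/2)`
(`W_Φ = whittakerCoeff ν₀ 𝓕_N ψ_K (invQuot Φ)`, Tate's character and box, Haar `ν₀`). Assembly: the
global corner theorem `stub_corner_global` (W-G) with `φ' := star Φ'` (`IsCuspFormGL.star`; the bridge
`whittakerDepth_zero_eq_whittakerCoeff`), one-factor absolute convergence `corner_abs_convergence_one` for
the integrability on `re s > σ₀ + 1/2`, the torus substitution `a ↦ τ a` (`torusPoint_mul`,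
`torusWeightC_mul`, `glCorner_glDiagonal_eq_glDiagonal_snoc`, left invariance of `νA`; as
`RankinSelbergTorusPairTranslate`), the honest translated unramified data at every `v ∉ S'`
(`HonestTranslateUnramified.stub_honest_translate_unramified` for `π` on `GL_{m+1}` with `T = diag(τ, 1)` and
for `σ` on `GL_m` with `T = diag τ`, `IsTorusUnramifiedAt.star`, `IsTorusUnramifiedAt.of_valued_eq`; bounds
`norm_satakeParameter_le_sqrt_holds`; central characters `exists_centralCharacter_invQuot`), the Euler
factorisation over all good places `CornerEulerLimit.stub_corner_euler_limit` and the Euler product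
`hasProd_partialPairL JacquetShalika1981_multipliable_partialPairL_holds` (at `s`, from the local factors at
`q_v^{-(s - 1/2 + 1/2)}`). -/
theorem corner_global_translate :
    ∀ {m : ℕ} {K : Type} [Field K] [NumberField K]
      [MeasurableSpace (AdeleRing (𝓞 K) K)] [BorelSpace (AdeleRing (𝓞 K) K)] (_hm : 0 < m)
      (μ : Measure (AdelicGroupData.gl (m + 1) K).automorphicQuotient)
      [(AdelicGroupData.gl (m + 1) K).IsAutomorphicMeasure μ]
      (μ' : Measure (AdelicGroupData.gl m K).automorphicQuotient) [(AdelicGroupData.gl m K).IsAutomorphicMeasure μ']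
      (νA : Measure (Fin m → ideleGroup K)) [IsHaarMeasure νA]
      (νK : Measure ↥(maximalCompactAdelic m K)) [IsHaarMeasure νK]
      (ν₀ : Measure ↥(adelicUnipotent (m + 1) K)) [IsHaarMeasure ν₀]
      (ν₀' : Measure ↥(adelicUnipotent m K)) [IsHaarMeasure ν₀'],
    ∃ C : ℝ, 0 < C ∧
      ∀ (P : CuspidalAutomorphicRepGL (m + 1) K μ) (Q : CuspidalAutomorphicRepGL m K μ')
        {S : Set (HeightOneSpectrum (𝓞 K))} {α γ : SatakeFamily K},
        IsSatakeFamilyOf P S α → IsSatakeFamilyOf Q S γ →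
      ∀ {Φ : (AdelicGroupData.gl (m + 1) K).automorphicQuotient → ℂ}
        {Φ' : (AdelicGroupData.gl m K).automorphicQuotient → ℂ}, Continuous Φ → Continuous Φ' →
      ∀ (sv : P.1.toSubmodule) (sv' : Q.1.toSubmodule),
        (((sv : (AdelicGroupData.gl (m + 1) K).L2 μ) : (AdelicGroupData.gl (m + 1) K).automorphicQuotient → ℂ)
          =ᵐ[μ] Φ) →
        (((sv' : (AdelicGroupData.gl m K).L2 μ') : (AdelicGroupData.gl m K).automorphicQuotient → ℂ) =ᵐ[μ'] Φ') →
        IsCuspFormGL (m + 1) K (isCompact_glFiniteIntegralLevel_holds (m + 1) K)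
          (invQuot (AdelicGroupData.gl (m + 1) K) Φ) →
        IsCuspFormGL m K (isCompact_glFiniteIntegralLevel_holds m K) (invQuot (AdelicGroupData.gl m K) Φ') →
      ∀ {𝔫₀ : Ideal (𝓞 K)}, 𝔫₀ ≠ 0 →
        (∀ k ∈ principalCongruenceLevel (m + 1) K 𝔫₀, ∀ y : GL (Fin (m + 1)) (AdeleRing (𝓞 K) K),
          invQuot (AdelicGroupData.gl (m + 1) K) Φ (y * k) = invQuot (AdelicGroupData.gl (m + 1) K) Φ y) →
        (∀ k ∈ principalCongruenceLevel m K 𝔫₀, ∀ y : GL (Fin m) (AdeleRing (𝓞 K) K),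
          invQuot (AdelicGroupData.gl m K) Φ' (y * k) = invQuot (AdelicGroupData.gl m K) Φ' y) →
      ∀ {S' : Set (HeightOneSpectrum (𝓞 K))}, S ⊆ S' → (∀ v ∉ S', ¬ v.asIdeal ∣ 𝔫₀) →
      ∀ (τ : Fin m → ideleGroup K),
        (∀ v ∉ S', ∃ (d : Fin (m + 1) → (v.adicCompletion K)ˣ) (a : (v.adicCompletion K)ˣ),
          localComponent v (glDiagonal (m + 1) (AdeleRing (𝓞 K) K) (Fin.snoc τ 1)) =
            diagonalGL (Fin (m + 1)) (v.adicCompletion K) d ∧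
          (∀ i j : Fin (m + 1), (i : ℕ) + 1 = j →
            (d i : v.adicCompletion K) * ((d j)⁻¹ : (v.adicCompletion K)ˣ) = a) ∧
          (∀ c ∈ 𝒪[v.adicCompletion K], (adeleAddChar K).adicComponent v (a * c) = 1) ∧
          ∀ ϖ : v.adicCompletion K, Valued.v ϖ = WithZero.exp (-1 : ℤ) →
            ∃ c ∈ 𝒪[v.adicCompletion K], (adeleAddChar K).adicComponent v (a * (ϖ⁻¹ * c)) ≠ 1) →
      ∀ {x : HeightOneSpectrum (𝓞 K) → Fin (m + 1) → ℂ} {y : HeightOneSpectrum (𝓞 K) → Fin m → ℂ},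
        (∀ v ∉ S', (Finset.univ : Finset (Fin (m + 1))).val.map (x v) = α v) →
        (∀ v ∉ S', (Finset.univ : Finset (Fin m)).val.map (y v) = γ v) →
      ∃ x₀ : ℝ, ∀ s : ℂ, x₀ < s.re →
        jpssIntegral (Nat.lt_succ_self m) μ' Φ (star Φ') s =
          (C : ℂ) * (torusWeightC m K (s - 1 / 2) τ *
            (partialPairL S' α (fun v => (γ v).map conj) s *
              ∫ p in unitBox {v | v ∉ S'} ×ˢ Set.univ, torusPairIntegrandC m K
                (fun g => whittakerCoeff ν₀ (unipotentTateDomain (m + 1) K) (adeleAddChar K)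
                  (invQuot (AdelicGroupData.gl (m + 1) K) Φ)
                  (glDiagonal (m + 1) (AdeleRing (𝓞 K) K) (Fin.snoc τ 1) *
                    glCorner (AdeleRing (𝓞 K) K) (Nat.le_succ m) g))
                (fun g => star (whittakerCoeff ν₀' (unipotentTateDomain m K) (adeleAddChar K)
                  (invQuot (AdelicGroupData.gl m K) Φ') (glDiagonal m (AdeleRing (𝓞 K) K) τ * g)))
                (fun _ => (1 : ℝ)) (s - 1 / 2) p ∂(νA.prod νK))) :=
  CornerGlobalTranslate.stub_corner_global_translate

/-- **W-CPF (LANDED p130375, `CornerUnitBoxProductForm.stub_corner_unitBox_productForm`; parts p129774 `CornerUnitBoxLocalValue`, p130020 `CornerUnitBoxPeel`) — support collapse and product form of the translated CORNER pair integrand on the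
unit box** (the `GL_{m+1} × GL_m` analogue of `UnitBoxTranslateProductForm.stub_unitBox_translate_productForm`;
Jacquet–Piatetski-Shapiro–Shalika (1983), §2, (2.7): at a finite place the local corner integral of suitable
data is a non-zero constant; Cogdell (2004), §4.1: `Ψ = ∏_v Ψ_v` for factorizable data). Abstractly in two
functions: `W` on `GL_{m+1}(𝔸_K)` left `ψ`-equivariant, central up to modulus one, right `K_f(𝔫)`-invariant
with the primes of `𝔫` in `T`, spread at every `v ∈ T` (`IsSpreadWhittakerAt`, the inequalities of the
support theorem WITHOUT the depth inequality — along the corner the last row is exactly `e_{m+1}`, so the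
thin condition of `valued_eq_one_of_torusIntegrand_thin_ne_zero` holds at every depth); `W'` on `GL_m(𝔸_K)`
left `ψ`-equivariant, right `K_f(𝔫)`-invariant and right `K_v(𝔭^M)`-invariant at `v ∈ T`; `τ ∈ (𝔸_Kˣ)ᵐ`
trivial at `T`; `I(s) = torusPairIntegrandC m K (W(diag(τ,1) ι ·)) (W̄'(diag τ ·)) 1 s` (`ι = glCorner`).
(i) `∫_{B({v ∉ T}) × K} I = ∫_{B(all) × K} I`; (ii) on `B(all) × K`,
`I(p) = F((diag a k)_f) · W(diag(τ,1) (ι(diag a k)_∞, 1)) · conj W'(diag τ ((diag a k)_∞, 1)) · |det a|_∞^s δ⁻¹`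
with `F ∈ {0, 1}`, `F(1) = 1`, `F` right `K_f(𝔪)`-invariant on `GL_m(𝒪̂)` for some `𝔪 ≠ 0`. -/
theorem corner_unitBox_productForm :
    ∀ {m : ℕ} {K : Type} [Field K] [NumberField K]
      [MeasurableSpace (AdeleRing (𝓞 K) K)] [BorelSpace (AdeleRing (𝓞 K) K)]
      (W : GL (Fin (m + 1)) (AdeleRing (𝓞 K) K) → ℂ) (W' : GL (Fin m) (AdeleRing (𝓞 K) K) → ℂ)
      (_ : ∀ (u : ↥(adelicUnipotent (m + 1) K)) (g : GL (Fin (m + 1)) (AdeleRing (𝓞 K) K)),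
        W ((u : GL (Fin (m + 1)) (AdeleRing (𝓞 K) K)) * g) = whittakerCharFun (adeleAddChar K) u * W g)
      (_ : ∀ (u : ↥(adelicUnipotent m K)) (g : GL (Fin m) (AdeleRing (𝓞 K) K)),
        W' ((u : GL (Fin m) (AdeleRing (𝓞 K) K)) * g) = whittakerCharFun (adeleAddChar K) u * W' g)
      (_ : ∀ (z : ideleGroup K) (g : GL (Fin (m + 1)) (AdeleRing (𝓞 K) K)),
        ‖W (Matrix.GeneralLinearGroup.scalar (Fin (m + 1)) z * g)‖ = ‖W g‖)
      {𝔫 : Ideal (𝓞 K)} (_ : 𝔫 ≠ 0)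
      (_ : ∀ u ∈ finitePrincipalCongruenceLevel (m + 1) K 𝔫, ∀ g : GL (Fin (m + 1)) (AdeleRing (𝓞 K) K),
        W (g * GLn.ofFinite (m + 1) K u) = W g)
      (_ : ∀ u ∈ finitePrincipalCongruenceLevel m K 𝔫, ∀ g : GL (Fin m) (AdeleRing (𝓞 K) K),
        W' (g * GLn.ofFinite m K u) = W' g)
      {T : Finset (HeightOneSpectrum (𝓞 K))} (_ : ∀ w : HeightOneSpectrum (𝓞 K), w.asIdeal ∣ 𝔫 → w ∈ T)
      (τ : Fin m → ideleGroup K) (_ : ∀ v ∈ T, localComponent v (glDiagonal m (AdeleRing (𝓞 K) K) τ) = 1)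
      (_ : ∀ v ∈ T, ∃ (tv : Fin (m + 1) → (v.adicCompletion K)ˣ) (M c₀ : ℤ),
          IsSpreadWhittakerAt v (adeleAddChar K) tv M W ∧
          (∃ y : v.adicCompletion K, Valued.v y ≤ exp (1 - c₀) ∧ (adeleAddChar K).adicComponent v y ≠ 1) ∧ 1 ≤ M ∧
          (∀ i j : Fin (m + 1), i ≤ j → Valued.v (tv j : v.adicCompletion K) ≤ Valued.v (tv i : v.adicCompletion K)) ∧
          (∀ i j : Fin (m + 1), (i : ℕ) + 1 = j →
            exp (M - c₀) * Valued.v (tv j : v.adicCompletion K) ≤ Valued.v (tv i : v.adicCompletion K)) ∧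
          ∀ κ ∈ valuedCongruenceSubgroup (Fin m) (exp (-M)), ∀ g : GL (Fin m) (AdeleRing (𝓞 K) K),
            W' (g * GLn.ofLocal m K v κ) = W' g)
      (νA : Measure (Fin m → ideleGroup K)) (νK : Measure ↥(maximalCompactAdelic m K)),
    let I : ℂ → (Fin m → ideleGroup K) × ↥(maximalCompactAdelic m K) → ℂ :=
      fun s => torusPairIntegrandC m K
        (fun g => W (glDiagonal (m + 1) (AdeleRing (𝓞 K) K) (Fin.snoc τ 1) * glCorner (AdeleRing (𝓞 K) K) (Nat.le_succ m) g))
        (fun g => star W' (glDiagonal m (AdeleRing (𝓞 K) K) τ * g)) (fun _ => (1 : ℝ)) s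
    ∃ (𝔪 : Ideal (𝓞 K)) (_ : 𝔪 ≠ 0) (F : GL (Fin m) (FiniteAdeleRing (𝓞 K) K) → ℂ),
      (∀ g ∈ glFiniteIntegralLevel m K, ∀ u ∈ finitePrincipalCongruenceLevel m K 𝔪, F (g * u) = F g) ∧
      (∀ g, F g = 0 ∨ F g = 1) ∧ F 1 = 1 ∧
      ∀ s : ℂ,
        (∫ p in unitBox {v | v ∉ (↑T : Set (HeightOneSpectrum (𝓞 K)))} ×ˢ Set.univ, I s p ∂(νA.prod νK) =
          ∫ p in unitBox (Set.univ : Set (HeightOneSpectrum (𝓞 K))) ×ˢ Set.univ, I s p ∂(νA.prod νK)) ∧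
        ∀ p : (Fin m → ideleGroup K) × ↥(maximalCompactAdelic m K),
          p.1 ∈ unitBox (n := m) (K := K) (Set.univ : Set (HeightOneSpectrum (𝓞 K))) →
          I s p = F (GLn.sndHom m K (torusPoint m K p)) *
            (W (glDiagonal (m + 1) (AdeleRing (𝓞 K) K) (Fin.snoc τ 1) *
              GLn.ofInfinite (m + 1) K (glCorner (mixedSpace K) (Nat.le_succ m) (GLn.toMixed m K (torusPoint m K p)))) *
            conj (W' (glDiagonal m (AdeleRing (𝓞 K) K) τ * GLn.ofInfinite m K (GLn.toMixed m K (torusPoint m K p)))) *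
            archTorusWeightC m K s (archTorusOfIdele m K p.1)) :=
  CornerUnitBoxProductForm.stub_corner_unitBox_productForm

/-- **STUB (named fact, XL) — Jacquet (2009), Thm. 2.7 (i) with Thm. 2.1 (i)**: the `K_∞`-finite finite-sum
realisation of `L(s, π_∞ × π'_∞)` by archimedean `GL_{m+1} × GL_m` corner integrals, the Literature fact
`JacquetArchimedeanRS2009_archRankinSelbergCorner_testVector` (landed p128621; nothing is proved for any rank). -/
theorem stub_jacquet_corner :
    ∀ (m : ℕ) (K : Type) [Field K] [NumberField K],
      JacquetArchimedeanRS2009_archRankinSelbergCorner_testVector m K := by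
  sorry

/-- **W-CAFD (LANDED p129558, `CornerArchFactorData.stub_corner_arch_factor_data`) — the archimedean corner data with their reciprocal entire factor `Λ`** (the corner
analogue of `archPairLFactorData_of_testVector`): from the named fact of Jacquet (2009), Thm. 2.7 (i), for
irreducible unitary `τ` (`GL_{m+1}(K_∞)`), `τ'` (`GL_m(K_∞)`) with non-zero continuous Whittaker functionals and
Haar measures, finitely many `K_∞`-finite Gårding `e_i`, `e'_i`, an ENTIRE `Λ` and an abscissa `x₀` with
`Λ(s) · Σ_i Ψ^corner_∞(s; e_i, e'_i) = 1` for `re s > x₀` (`Λ = c^{-s} ∏_j Γ_ℝ(s + a_j)⁻¹ ∏_j Γ_ℂ(s + b_j)⁻¹`,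
entire because `1/Γ` is entire: `Complex.differentiable_one_div_Gamma`). -/
theorem corner_arch_factor_data :
    ∀ {m : ℕ} {K : Type} [Field K] [NumberField K],
      JacquetArchimedeanRS2009_archRankinSelbergCorner_testVector m K →
    ∀ (hcpt : isCompact_glFiniteIntegralLevel (m + 1) K) (hcpt' : isCompact_glFiniteIntegralLevel m K)
      (E : Type) [NormedAddCommGroup E] [InnerProductSpace ℂ E] [CompleteSpace E]
      (τ : ContRepresentation ℂ (AutomorphyDatum.gl (m + 1) K hcpt).arch.carrier E) (hτ : τ.IsStronglyContinuous)
      (_ : τ.IsUnitary) (_ : τ.IsTopIrreducible)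
      (ℓ : archGardingSpace hcpt τ →ₗ[ℂ] ℂ) (_ : IsArchContWhittakerFunctional hcpt τ hτ ℓ) (_ : ℓ ≠ 0)
      (E' : Type) [NormedAddCommGroup E'] [InnerProductSpace ℂ E'] [CompleteSpace E']
      (τ' : ContRepresentation ℂ (AutomorphyDatum.gl m K hcpt').arch.carrier E') (hτ' : τ'.IsStronglyContinuous)
      (_ : τ'.IsUnitary) (_ : τ'.IsTopIrreducible)
      (ℓ' : archGardingSpace hcpt' τ' →ₗ[ℂ] ℂ) (_ : IsArchContWhittakerFunctional hcpt' τ' hτ' ℓ') (_ : ℓ' ≠ 0)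
      [MeasurableSpace (GL (Fin m) (mixedSpace K))] [BorelSpace (GL (Fin m) (mixedSpace K))]
      [MeasurableSpace ((mixedSpace K)ˣ)] [BorelSpace ((mixedSpace K)ˣ)]
      (μA : Measure (Fin m → (mixedSpace K)ˣ)) (_ : IsHaarMeasure μA)
      (μK : Measure ↥(Kinf m K)) (_ : IsHaarMeasure μK),
      ∃ (k : ℕ) (e : Fin k → archGardingSpace hcpt τ) (e' : Fin k → archGardingSpace hcpt' τ')
        (_ : ∀ i, FiniteDimensional ℂ (Submodule.span ℂ (Set.range
          fun κ : (AutomorphyDatum.gl (m + 1) K hcpt).arch.maximalCompact =>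
            τ (toArch hcpt (κ : GL (Fin (m + 1)) (mixedSpace K))) (e i : E))))
        (_ : ∀ i, FiniteDimensional ℂ (Submodule.span ℂ (Set.range
          fun κ : (AutomorphyDatum.gl m K hcpt').arch.maximalCompact =>
            τ' (toArch hcpt' (κ : GL (Fin m) (mixedSpace K))) (e' i : E'))))
        (Λ : ℂ → ℂ) (x₀ : ℝ), Differentiable ℂ Λ ∧ ∀ s : ℂ, x₀ < s.re →
          Λ s * ∑ i, archCornerPairIntegralCplx hcpt hcpt' τ hτ τ' hτ' ℓ ℓ' (e i) (e' i) μA μK s = 1 :=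
  CornerArchFactorData.stub_corner_arch_factor_data

/-- **W-CLSD (LANDED p130763, `CornerLocalSingleDatum.stub_corner_local_single_datum`) — ONE archimedean corner datum realised inside the translated corner box integral**
(the `GL_{m+1} × GL_m` analogue of `LocalSingleDatum.stub_local_single_datum`; Jacquet–Piatetski-Shapiro–Shalika
(1983), (2.7) at the finite places of `S₀` by spread data; Cogdell (2004), §4.1, `Ψ = ∏_v Ψ_v` for factorizable
data). Given torus shifts `τ ∈ (𝔸_Kˣ)ᵐ` with `diag τ` trivial at `S₀ ∪ ∞`, pure tensors `S₁ ∈ π_f` (`π` cuspidal on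
`GL_{m+1}`), `S₁' ∈ σ_f` (`σ` cuspidal on `GL_m`) of levels `K_f(𝔫P)`, `K_f(𝔫Q)` with `𝔫P 𝔫Q` supported on `S₀`, and
`K_∞`-finite Gårding vectors `e`, `e'` of the archimedean components `τP`, `τQ`, there are a level `𝔫` supported on
`S₀`, HONEST continuous representatives `Φ`, `Φ'` (`IsCuspFormGL` of `invQuot`, right `K(𝔫)`-invariant) of vectors
`sv ∈ π`, `sv' ∈ σ` (the smoothed forms `S_η f`, `S_{η'} f'` of c3's M1 and their classes `R(η) f`, `R(η') f'`), and
`κ > 0` with, for every `s`,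
`∫_{B({v ∉ S₀}) × K} W_Φ(diag(τ,1) ι ·) W̄_{Φ'}(diag τ ·) |det|^s δ⁻¹ = κ · Ψ^corner_∞(s; Φ_λ(diag(τ,1)_f S₁), Φ_λ'(diag(τ)_f S₁'), e, e')`
(`archCornerPairIntegralCplx` against the image Haar measures). Assembly as c3's M1 with the corner product form
`stub_corner_unitBox_productForm`, `TranslateArchValue.stub_translate_arch_value` at corner points, the spread datum
for `π`, level-weight fixing for `e`, `e'` separately, coset averaging, and honesty by
`isAutomorphicForm_invQuot_smoothedForm_of_fixed` + `isCuspFormGL_invQuot_of_mem_cuspidalSubspace_holds`; the finite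
set off which `diag τ` is integral is constructed inside (ideles are units almost everywhere). -/
theorem corner_local_single_datum :
    ∀ {m : ℕ} {K : Type} [Field K] [NumberField K]
      {μ : Measure (gl (m + 1) K).automorphicQuotient} [(gl (m + 1) K).IsAutomorphicMeasure μ]
      {μ' : Measure (gl m K).automorphicQuotient} [(gl m K).IsAutomorphicMeasure μ']
      [MeasurableSpace (AdeleRing (𝓞 K) K)] [BorelSpace (AdeleRing (𝓞 K) K)] (_ : 0 < m)
      (hcpt : isCompact_glFiniteIntegralLevel (m + 1) K) (hcpt' : isCompact_glFiniteIntegralLevel m K)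
      (P : CuspidalAutomorphicRepGL (m + 1) K μ) (Q : CuspidalAutomorphicRepGL m K μ')
      (νA : Measure (Fin m → ideleGroup K)) [IsHaarMeasure νA]
      (νK : Measure ↥(maximalCompactAdelic m K)) [IsHaarMeasure νK]
      (ν₀ : Measure ↥(adelicUnipotent (m + 1) K)) [IsHaarMeasure ν₀]
      (ν₀' : Measure ↥(adelicUnipotent m K)) [IsHaarMeasure ν₀']
      {E : Type} [NormedAddCommGroup E] [InnerProductSpace ℂ E] [CompleteSpace E]
      {τP : ContRepresentation ℂ (archGroupGL (m + 1) K).carrier E} (hτPc : τP.IsStronglyContinuous)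
      {E' : Type} [NormedAddCommGroup E'] [InnerProductSpace ℂ E'] [CompleteSpace E']
      {τQ : ContRepresentation ℂ (archGroupGL m K).carrier E'} (hτQc : τQ.IsStronglyContinuous)
      (S₀ : Finset (HeightOneSpectrum (𝓞 K))) (τ : Fin m → ideleGroup K)
      (_ : GLn.toMixed m K (glDiagonal m (AdeleRing (𝓞 K) K) τ) = 1)
      (_ : ∀ v ∈ S₀, localComponent v (glDiagonal m (AdeleRing (𝓞 K) K) τ) = 1)
      {𝔫P 𝔫Q : Ideal (𝓞 K)} (_ : 𝔫P ≠ 0) (_ : 𝔫Q ≠ 0)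
      (_ : ∀ w ∉ S₀, ¬ w.asIdeal ∣ 𝔫P * 𝔫Q)
      (S₁ : multiplicityModule hcpt τP P.1)
      (_ : (S₁ : E →L[ℂ] (gl (m + 1) K).L2 μ) ∈ archIntertwinersLevel hcpt τP P.1 (finitePrincipalCongruenceLevel (m + 1) K 𝔫P))
      (S₁' : multiplicityModule hcpt' τQ Q.1)
      (_ : (S₁' : E' →L[ℂ] (gl m K).L2 μ') ∈ archIntertwinersLevel hcpt' τQ Q.1 (finitePrincipalCongruenceLevel m K 𝔫Q))
      (e : archGardingSpace hcpt τP) (e' : archGardingSpace hcpt' τQ)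
      (_ : FiniteDimensional ℂ (Submodule.span ℂ (Set.range
        fun κ : ↥(Kinf (m + 1) K) => τP (toArch hcpt κ.1) e.1)))
      (_ : FiniteDimensional ℂ (Submodule.span ℂ (Set.range
        fun κ : ↥(Kinf m K) => τQ (toArch hcpt' κ.1) e'.1)))
      [MeasurableSpace (GL (Fin m) (mixedSpace K))] [BorelSpace (GL (Fin m) (mixedSpace K))],
    ∃ (𝔫 : Ideal (𝓞 K)) (_ : 𝔫 ≠ 0) (_ : ∀ w ∉ S₀, ¬ w.asIdeal ∣ 𝔫)
      (Φ : (gl (m + 1) K).automorphicQuotient → ℂ) (Φ' : (gl m K).automorphicQuotient → ℂ)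
      (sv : P.1.toSubmodule) (sv' : Q.1.toSubmodule) (_ : Continuous Φ) (_ : Continuous Φ')
      (_ : ((sv : (gl (m + 1) K).L2 μ) : _ → ℂ) =ᵐ[μ] Φ)
      (_ : ((sv' : (gl m K).L2 μ') : _ → ℂ) =ᵐ[μ'] Φ')
      (_ : IsCuspFormGL (m + 1) K hcpt (invQuot (gl (m + 1) K) Φ))
      (_ : IsCuspFormGL m K hcpt' (invQuot (gl m K) Φ'))
      (_ : ∀ u ∈ principalCongruenceLevel (m + 1) K 𝔫, ∀ y, invQuot (gl (m + 1) K) Φ (y * u :) = invQuot (gl (m + 1) K) Φ y)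
      (_ : ∀ u ∈ principalCongruenceLevel m K 𝔫, ∀ y, invQuot (gl m K) Φ' (y * u :) = invQuot (gl m K) Φ' y)
      (κ : ℝ), 0 < κ ∧
      ∀ s,
        ∫ p in unitBox {v | v ∉ (↑S₀ : Set _)} ×ˢ univ,
          torusPairIntegrandC m K
            (fun g => whittakerCoeff ν₀ (unipotentTateDomain (m + 1) K) (adeleAddChar K) (invQuot (gl (m + 1) K) Φ)
              (glDiagonal (m + 1) (AdeleRing (𝓞 K) K) (Fin.snoc τ 1) * glCorner (AdeleRing (𝓞 K) K) (Nat.le_succ m) g))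
            (fun g => star (whittakerCoeff ν₀' (unipotentTateDomain m K) (adeleAddChar K) (invQuot (gl m K) Φ')
              (glDiagonal m (AdeleRing (𝓞 K) K) τ * g)))
            (fun _ => 1) s p ∂(νA.prod νK) =
        (κ : ℂ) * archCornerPairIntegralCplx hcpt hcpt' τP hτPc τQ hτQc
          (transferMap (whittakerFunctional ν₀ (continuous_adeleAddChar K) (ContRepresentation.Equiv.refl P.1.toContRep)) hτPc
            (finComponentRep hcpt τP P.1 (GLn.sndHom (m + 1) K (glDiagonal (m + 1) (AdeleRing (𝓞 K) K) (Fin.snoc τ 1))) S₁))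
          (transferMap (whittakerFunctional ν₀' (continuous_adeleAddChar K) (ContRepresentation.Equiv.refl Q.1.toContRep)) hτQc
            (finComponentRep hcpt' τQ Q.1 (GLn.sndHom m K (glDiagonal m (AdeleRing (𝓞 K) K) τ)) S₁')) e e'
          ((νA.restrict (unitBox univ)).map (archTorusOfIdele m K)) (νK.map (kinfOfMaximalCompact m K)) s :=
  CornerLocalSingleDatum.stub_corner_local_single_datum

/-- **W-CLC (LANDED p131085, `CornerLocalControlAsm.stub_corner_local_control` = `corner_local_control_of_parts` applied to `CornerArchFactorData` + `CornerLocalSingleDatum`; the corner LOCAL control; the `GL_{m+1} × GL_m` analogue of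
`LocalPairTranslate.stub_local_pair_translate`)** — the local Rankin–Selberg theory of a cuspidal pair
`(π, σ)` on `GL_{m+1}(𝔸_K) × GL_m(𝔸_K)` along the corner, in translate form, GRANTED the archimedean fact of
Jacquet (2009) (hypothesis): for a finite `S₀` off which both are unramified there are a torus of Whittaker
shifts `τ ∈ (𝔸_Kˣ)ᵐ` (its extension `(τ, 1)` correcting the conductor of Tate's character off `S₀`), finitely
many data `(c_i, Φ_i, Φ'_i)` — HONEST continuous representatives `Φ_i`, `Φ'_i` (`IsCuspFormGL` of
`invQuot`, by `isAutomorphicForm_invQuot_smoothedForm_of_fixed` for smoothed `K_∞`-finite fixed vectors) of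
vectors `sv_i ∈ π`, `sv'_i ∈ σ` with ONE level `𝔫₀` supported on `S₀` — and an ENTIRE `Λ` with, on a right
half-plane, `Λ(s) · Σ_i c_i · ∫_{B({v ∉ S₀}) × K} W_{Φ_i}(diag(τ,1) ι ·) W̄_{Φ'_i}(diag τ ·) |det|^s δ⁻¹ = 1`
(JPSS (1983), Thm. 2.7 at the finite places of `S₀` by spread data and the corner product form
`stub_corner_unitBox_productForm`; Cogdell (2004), §4.1, `Ψ = ∏_v Ψ_v`; the archimedean data and `Λ` from the
hypothesis through `archCornerPairIntegralCplx`, the corner version of `LocalSingleDatum.stub_local_single_datum`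
with `TranslateArchValue.stub_translate_arch_value` at corner points). -/
theorem corner_local_control :
    (∀ (N : ℕ) (K : Type) [Field K] [NumberField K],
      JacquetArchimedeanRS2009_archRankinSelbergCorner_testVector N K) →
    ∀ {m : ℕ} {K : Type} [Field K] [NumberField K]
      {μ : Measure (AdelicGroupData.gl (m + 1) K).automorphicQuotient}
      [(AdelicGroupData.gl (m + 1) K).IsAutomorphicMeasure μ]
      {μ' : Measure (AdelicGroupData.gl m K).automorphicQuotient} [(AdelicGroupData.gl m K).IsAutomorphicMeasure μ']
      [MeasurableSpace (AdeleRing (𝓞 K) K)] [BorelSpace (AdeleRing (𝓞 K) K)] (_hm : 0 < m)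
      (νA : Measure (Fin m → ideleGroup K)) [IsHaarMeasure νA]
      (νK : Measure ↥(maximalCompactAdelic m K)) [IsHaarMeasure νK]
      (ν₀ : Measure ↥(adelicUnipotent (m + 1) K)) [IsHaarMeasure ν₀]
      (ν₀' : Measure ↥(adelicUnipotent m K)) [IsHaarMeasure ν₀']
      (P : CuspidalAutomorphicRepGL (m + 1) K μ) (Q : CuspidalAutomorphicRepGL m K μ')
      (S₀ : Finset (HeightOneSpectrum (𝓞 K))), (∀ v ∉ S₀, IsUnramifiedAt P.1 v ∧ IsUnramifiedAt Q.1 v) →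
      ∃ (τ : Fin m → ideleGroup K),
      (∀ v ∉ S₀, ∃ (d : Fin (m + 1) → (v.adicCompletion K)ˣ) (a : (v.adicCompletion K)ˣ),
        localComponent v (glDiagonal (m + 1) (AdeleRing (𝓞 K) K) (Fin.snoc τ 1)) =
          diagonalGL (Fin (m + 1)) (v.adicCompletion K) d ∧
        (∀ i j : Fin (m + 1), (i : ℕ) + 1 = j →
          (d i : v.adicCompletion K) * ((d j)⁻¹ : (v.adicCompletion K)ˣ) = a) ∧
        (∀ c ∈ 𝒪[v.adicCompletion K], (adeleAddChar K).adicComponent v (a * c) = 1) ∧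
        ∀ ϖ : v.adicCompletion K, Valued.v ϖ = WithZero.exp (-1 : ℤ) →
          ∃ c ∈ 𝒪[v.adicCompletion K], (adeleAddChar K).adicComponent v (a * (ϖ⁻¹ * c)) ≠ 1) ∧
      ∃ (k : ℕ) (c : Fin k → ℂ)
        (Φ : Fin k → (AdelicGroupData.gl (m + 1) K).automorphicQuotient → ℂ)
        (Φ' : Fin k → (AdelicGroupData.gl m K).automorphicQuotient → ℂ)
        (sv : Fin k → P.1.toSubmodule) (sv' : Fin k → Q.1.toSubmodule) (𝔫₀ : Ideal (𝓞 K)),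
      𝔫₀ ≠ 0 ∧ (∀ w : HeightOneSpectrum (𝓞 K), w.asIdeal ∣ 𝔫₀ → w ∈ S₀) ∧
      (∀ i, Continuous (Φ i)) ∧ (∀ i, Continuous (Φ' i)) ∧
      (∀ i, (((sv i : (AdelicGroupData.gl (m + 1) K).L2 μ) : (AdelicGroupData.gl (m + 1) K).automorphicQuotient → ℂ)
        =ᵐ[μ] Φ i)) ∧
      (∀ i, (((sv' i : (AdelicGroupData.gl m K).L2 μ') : (AdelicGroupData.gl m K).automorphicQuotient → ℂ)
        =ᵐ[μ'] Φ' i)) ∧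
      (∀ i, IsCuspFormGL (m + 1) K (isCompact_glFiniteIntegralLevel_holds (m + 1) K)
        (invQuot (AdelicGroupData.gl (m + 1) K) (Φ i))) ∧
      (∀ i, IsCuspFormGL m K (isCompact_glFiniteIntegralLevel_holds m K) (invQuot (AdelicGroupData.gl m K) (Φ' i))) ∧
      (∀ i, ∀ u ∈ principalCongruenceLevel (m + 1) K 𝔫₀, ∀ y : GL (Fin (m + 1)) (AdeleRing (𝓞 K) K),
        invQuot (AdelicGroupData.gl (m + 1) K) (Φ i) (y * u) = invQuot (AdelicGroupData.gl (m + 1) K) (Φ i) y) ∧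
      (∀ i, ∀ u ∈ principalCongruenceLevel m K 𝔫₀, ∀ y : GL (Fin m) (AdeleRing (𝓞 K) K),
        invQuot (AdelicGroupData.gl m K) (Φ' i) (y * u) = invQuot (AdelicGroupData.gl m K) (Φ' i) y) ∧
      ∃ (Λ : ℂ → ℂ) (x₁ : ℝ), Differentiable ℂ Λ ∧ ∀ s : ℂ, x₁ < s.re →
        Λ s * ∑ i, c i * ∫ p in unitBox {v | v ∉ (↑S₀ : Set (HeightOneSpectrum (𝓞 K)))} ×ˢ Set.univ,
          torusPairIntegrandC m K
            (fun g => whittakerCoeff ν₀ (unipotentTateDomain (m + 1) K) (adeleAddChar K)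
              (invQuot (AdelicGroupData.gl (m + 1) K) (Φ i))
              (glDiagonal (m + 1) (AdeleRing (𝓞 K) K) (Fin.snoc τ 1) * glCorner (AdeleRing (𝓞 K) K) (Nat.le_succ m) g))
            (fun g => star (whittakerCoeff ν₀' (unipotentTateDomain m K) (adeleAddChar K)
              (invQuot (AdelicGroupData.gl m K) (Φ' i)) (glDiagonal m (AdeleRing (𝓞 K) K) τ * g)))
            (fun _ => (1 : ℝ)) s p ∂(νA.prod νK) = 1 :=
  CornerLocalControlAsm.stub_corner_local_control

/-! ## The corner heart DERIVED: the entire quotient representation from the global translate theorem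
(W-CGT) and the local control (W-CLC) -/

/-- **The corner heart from the global translate theorem and the local control, granted the archimedean
fact of Jacquet (2009).** For cuspidal `π` on `GL_{m+1}`, `σ` on `GL_m` (`0 < m`), a finite `S₀` off which
both are unramified, Satake families `α₀`, `β₀` off `S₀` and any `s₀`: `J := Λ(s - 1/2) Σ_i c_i I(s; Φ_i, Φ̄'_i)`
is entire (`differentiable_jpssIntegral_of_isCuspFormGL`, `IsCuspFormGL.star`), `A := C · w_{s-1/2}(τ)` is entire
and zero-free (`differentiable_torusWeightC`, `torusWeightC_ne_zero`), and `J = A · L^{S₀}(s, α₀ ⊗ β₀)` on a right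
half-plane by `stub_corner_global_translate` at `(π, σ̄, γ = β̄₀)` (`IsSatakeFamilyOf.conj`,
`isUnramifiedAt_conj_iff`, `multiset_map_conj_map_conj`, enumerations `exists_univ_val_map_eq`) and the local
identity of `stub_corner_local_control` at the parameter `s - 1/2`. [cite: CogdellAnalyticTheory2004, Thm. 4.2 and §4.2] -/
theorem corner_entire_quotient_of_local_control
    (hJ : ∀ (N : ℕ) (K : Type) [Field K] [NumberField K],
      JacquetArchimedeanRS2009_archRankinSelbergCorner_testVector N K) :
    ∀ {m : ℕ} {K : Type} [Field K] [NumberField K]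
      {μ : Measure (gl (m + 1) K).automorphicQuotient} [(gl (m + 1) K).IsAutomorphicMeasure μ]
      {μ' : Measure (gl m K).automorphicQuotient} [(gl m K).IsAutomorphicMeasure μ']
      (_hm : 0 < m) (P : CuspidalAutomorphicRepGL (m + 1) K μ) (P' : CuspidalAutomorphicRepGL m K μ')
      (S₀ : Finset (HeightOneSpectrum (𝓞 K)))
      (_hS₀ : ∀ v ∉ S₀, IsUnramifiedAt P.1 v ∧ IsUnramifiedAt P'.1 v)
      {α₀ β₀ : SatakeFamily K} (_hα₀ : IsSatakeFamilyOf P (↑S₀ : Set (HeightOneSpectrum (𝓞 K))) α₀)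
      (_hβ₀ : IsSatakeFamilyOf P' (↑S₀ : Set (HeightOneSpectrum (𝓞 K))) β₀) (s₀ : ℂ),
      ∃ (x₀ : ℝ) (J A : ℂ → ℂ), Differentiable ℂ J ∧ Differentiable ℂ A ∧ A s₀ ≠ 0 ∧
        ∀ s : ℂ, x₀ < s.re → J s = A s * partialPairL (↑S₀ : Set (HeightOneSpectrum (𝓞 K))) α₀ β₀ s := by
  intro m K _ _ μ _ μ' _ hm P P' S₀ hS₀ α₀ β₀ hα₀ hβ₀ s₀
  classical
  -- instances, as in `IsOrthoOfLocalTranslate.stub_isOrtho_of_local_translate`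
  haveI : T2Space (AdeleRing (𝓞 K) K) := t2Space_adeleRing K
  letI : MeasurableSpace (AdeleRing (𝓞 K) K) := borel _
  haveI : BorelSpace (AdeleRing (𝓞 K) K) := ⟨rfl⟩
  haveI := borelSpace_ideleGroup K
  haveI := locallyCompactSpace_ideleGroup K
  haveI := secondCountableTopology_ideleGroup K
  haveI := secondCountableTopology_adeleRing K
  haveI := locallyCompactSpace_adeleRing' K
  haveI : T2Space (GL (Fin (m + 1)) (AdeleRing (𝓞 K) K)) := t2Space_gl (m + 1) K
  haveI : T2Space (GL (Fin m) (AdeleRing (𝓞 K) K)) := t2Space_gl m K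
  haveI : LocallyCompactSpace (GL (Fin (m + 1)) (AdeleRing (𝓞 K) K)) :=
    AdelicGroupData.locallyCompactSpace_generalLinearGroup_adeleRing K (Fin (m + 1))
  haveI : LocallyCompactSpace (GL (Fin m) (AdeleRing (𝓞 K) K)) :=
    AdelicGroupData.locallyCompactSpace_generalLinearGroup_adeleRing K (Fin m)
  haveI := secondCountableTopology_generalLinearGroup_adeleRing K (Fin (m + 1))
  haveI := secondCountableTopology_generalLinearGroup_adeleRing K (Fin m)
  haveI : CompactSpace ↥(maximalCompactAdelic m K) :=
    isCompact_iff_compactSpace.1 (isCompact_maximalCompactAdelic m K)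
  haveI : LocallyCompactSpace ↥(adelicUnipotent (m + 1) K) := (isClosed_adelicUnipotent (m + 1) K).locallyCompactSpace
  haveI : LocallyCompactSpace ↥(adelicUnipotent m K) := (isClosed_adelicUnipotent m K).locallyCompactSpace
  -- Haar measures
  obtain ⟨νA, hνA⟩ : ∃ ν : Measure (Fin m → ideleGroup K), IsHaarMeasure ν := ⟨Measure.haar, inferInstance⟩
  obtain ⟨νK, hνK⟩ : ∃ ν : Measure ↥(maximalCompactAdelic m K), IsHaarMeasure ν := ⟨Measure.haar, inferInstance⟩
  obtain ⟨ν₀, hν₀⟩ : ∃ ν : Measure ↥(adelicUnipotent (m + 1) K), IsHaarMeasure ν := ⟨Measure.haar, inferInstance⟩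
  obtain ⟨ν₀', hν₀'⟩ : ∃ ν : Measure ↥(adelicUnipotent m K), IsHaarMeasure ν := ⟨Measure.haar, inferInstance⟩
  -- `π` and `σ̄` are unramified off `S₀`
  have hU : ∀ v ∉ S₀, IsUnramifiedAt P.1 v ∧ IsUnramifiedAt P'.conj.1 v := fun v hv =>
    ⟨(hS₀ v hv).1, isUnramifiedAt_conj_iff.2 (hS₀ v hv).2⟩
  -- the local control datum at `(π, σ̄, S₀)`
  obtain ⟨τ, hτψ, k, c, Φ, Φ', sv, sv', 𝔫₀, h𝔫₀, h𝔫₀S, hΦc, hΦ'c, hae, hae', hΦcusp, hΦ'cusp, hΦU, hΦ'U,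
    Λ, x₁, hΛ, hΛsum⟩ := corner_local_control hJ hm νA νK ν₀ ν₀' P P'.conj S₀ hU
  -- the global translate theorem
  obtain ⟨C, hC, hT⟩ := corner_global_translate hm μ μ' νA νK ν₀ ν₀'
  have hS' : ∀ v ∉ (↑S₀ : Set (HeightOneSpectrum (𝓞 K))), ¬ v.asIdeal ∣ 𝔫₀ := fun v hv h =>
    hv (Finset.mem_coe.2 (h𝔫₀S v h))
  -- enumerations of the Satake parameters of `π`, `σ̄` off `S₀`
  have hexx : ∀ v : HeightOneSpectrum (𝓞 K), ∃ x : Fin (m + 1) → ℂ, v ∉ (↑S₀ : Set (HeightOneSpectrum (𝓞 K))) →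
      (Finset.univ : Finset (Fin (m + 1))).val.map x = α₀ v := by
    intro v
    by_cases hv : v ∉ (↑S₀ : Set (HeightOneSpectrum (𝓞 K)))
    · obtain ⟨x, hx⟩ := exists_univ_val_map_eq (hα₀.card_eq hv)
      exact ⟨x, fun _ => hx⟩
    · exact ⟨fun _ => 0, fun h => absurd h hv⟩
  have hexy : ∀ v : HeightOneSpectrum (𝓞 K), ∃ y : Fin m → ℂ, v ∉ (↑S₀ : Set (HeightOneSpectrum (𝓞 K))) →
      (Finset.univ : Finset (Fin m)).val.map y = (β₀ v).map conj := by
    intro v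
    by_cases hv : v ∉ (↑S₀ : Set (HeightOneSpectrum (𝓞 K)))
    · obtain ⟨y, hy⟩ := exists_univ_val_map_eq (R := ℂ) (m := m) (α := (β₀ v).map conj)
        (by rw [Multiset.card_map]; exact hβ₀.card_eq hv)
      exact ⟨y, fun _ => hy⟩
    · exact ⟨fun _ => 0, fun h => absurd h hv⟩
  choose x hx using hexx
  choose y hy using hexy
  have hββ : (fun v => ((β₀ v).map conj).map conj) = β₀ := funext fun v => multiset_map_conj_map_conj _
  -- the strip identities, one for each datum
  choose xf hxf using fun i : Fin k =>
    hT P P'.conj hα₀ hβ₀.conj (hΦc i) (hΦ'c i) (sv i) (sv' i) (hae i) (hae' i) (hΦcusp i) (hΦ'cusp i) h𝔫₀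
      (hΦU i) (hΦ'U i) Set.Subset.rfl hS' τ (fun v hv => hτψ v fun h => hv (Finset.mem_coe.2 h)) hx hy
  -- the entire functions
  set xmax : ℝ := (∑ i, |xf i|) + |x₁| + 1 with hxmax
  have hC0 : (C : ℂ) ≠ 0 := Complex.ofReal_ne_zero.2 hC.ne'
  refine ⟨xmax, fun s => Λ (s - 1 / 2) * ∑ i, c i * jpssIntegral (Nat.lt_succ_self m) μ' (Φ i) (star (Φ' i)) s,
    fun s => (C : ℂ) * torusWeightC m K (s - 1 / 2) τ, ?_, ?_, ?_, ?_⟩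
  · -- `J` is entire
    have hΛ' : Differentiable ℂ fun s : ℂ => Λ (s - 1 / 2) := hΛ.comp (differentiable_id.sub_const _)
    have hI : ∀ i, Differentiable ℂ (jpssIntegral (Nat.lt_succ_self m) μ' (Φ i) (star (Φ' i))) := fun i =>
      (differentiable_jpssIntegral_of_isCuspFormGL (μ' := μ') hm (Nat.lt_succ_self m) (hΦcusp i)
        (φ' := star (Φ' i)) (hΦ'cusp i).star).1
    have hsum : Differentiable ℂ fun s => ∑ i, c i * jpssIntegral (Nat.lt_succ_self m) μ' (Φ i) (star (Φ' i)) s := by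
      have h : Differentiable ℂ (∑ i, fun s => c i * jpssIntegral (Nat.lt_succ_self m) μ' (Φ i) (star (Φ' i)) s) :=
        Differentiable.sum fun i _ => (hI i).const_mul (c i)
      convert h using 1
      funext s
      simp only [Finset.sum_apply]
    exact hΛ'.mul hsum
  · -- `A` is entire
    exact ((differentiable_torusWeightC τ).comp (differentiable_id.sub_const _)).const_mul _
  · -- `A s₀ ≠ 0`
    exact mul_ne_zero hC0 (torusWeightC_ne_zero _ τ)
  · -- the identity on `re s > xmax`
    intro s hs
    have habs : ∀ i, xf i < s.re := fun i => by
      have h1 : xf i ≤ |xf i| := le_abs_self _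
      have h2 : |xf i| ≤ ∑ j, |xf j| := Finset.single_le_sum (fun j _ => abs_nonneg (xf j)) (Finset.mem_univ i)
      have h3 : (0 : ℝ) ≤ |x₁| := abs_nonneg _
      linarith
    have hs₁ : x₁ < (s - 1 / 2).re := by
      have h1 : x₁ ≤ |x₁| := le_abs_self _
      have h2 : (0 : ℝ) ≤ ∑ j, |xf j| := Finset.sum_nonneg fun j _ => abs_nonneg (xf j)
      simp only [Complex.sub_re, Complex.div_ofNat_re, Complex.one_re]
      linarith
    have hloc := hΛsum (s - 1 / 2) hs₁
    -- each global integral on the half-plane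
    have hterm : ∀ i, jpssIntegral (Nat.lt_succ_self m) μ' (Φ i) (star (Φ' i)) s =
        (C : ℂ) * (torusWeightC m K (s - 1 / 2) τ *
          (partialPairL (↑S₀ : Set (HeightOneSpectrum (𝓞 K))) α₀ β₀ s *
            ∫ p in unitBox {v | v ∉ (↑S₀ : Set (HeightOneSpectrum (𝓞 K)))} ×ˢ Set.univ, torusPairIntegrandC m K
              (fun g => whittakerCoeff ν₀ (unipotentTateDomain (m + 1) K) (adeleAddChar K)
                (invQuot (AdelicGroupData.gl (m + 1) K) (Φ i))
                (glDiagonal (m + 1) (AdeleRing (𝓞 K) K) (Fin.snoc τ 1) * glCorner (AdeleRing (𝓞 K) K) (Nat.le_succ m) g))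
              (fun g => star (whittakerCoeff ν₀' (unipotentTateDomain m K) (adeleAddChar K)
                (invQuot (AdelicGroupData.gl m K) (Φ' i)) (glDiagonal m (AdeleRing (𝓞 K) K) τ * g)))
              (fun _ => (1 : ℝ)) (s - 1 / 2) p ∂(νA.prod νK))) := by
      intro i
      have h := hxf i s (habs i)
      rw [hββ] at h
      exact h
    simp_rw [hterm]
    -- `Λ · ∑ c_i (C w L Ψ_i) = C w L · (Λ ∑ c_i Ψ_i) = C w L`
    have hre : ∑ i, c i * ((C : ℂ) * (torusWeightC m K (s - 1 / 2) τ *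
        (partialPairL (↑S₀ : Set (HeightOneSpectrum (𝓞 K))) α₀ β₀ s *
          ∫ p in unitBox {v | v ∉ (↑S₀ : Set (HeightOneSpectrum (𝓞 K)))} ×ˢ Set.univ, torusPairIntegrandC m K
            (fun g => whittakerCoeff ν₀ (unipotentTateDomain (m + 1) K) (adeleAddChar K)
              (invQuot (AdelicGroupData.gl (m + 1) K) (Φ i))
              (glDiagonal (m + 1) (AdeleRing (𝓞 K) K) (Fin.snoc τ 1) * glCorner (AdeleRing (𝓞 K) K) (Nat.le_succ m) g))
            (fun g => star (whittakerCoeff ν₀' (unipotentTateDomain m K) (adeleAddChar K)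
              (invQuot (AdelicGroupData.gl m K) (Φ' i)) (glDiagonal m (AdeleRing (𝓞 K) K) τ * g)))
            (fun _ => (1 : ℝ)) (s - 1 / 2) p ∂(νA.prod νK)))) =
      (C : ℂ) * torusWeightC m K (s - 1 / 2) τ * partialPairL (↑S₀ : Set (HeightOneSpectrum (𝓞 K))) α₀ β₀ s *
        ∑ i, c i * ∫ p in unitBox {v | v ∉ (↑S₀ : Set (HeightOneSpectrum (𝓞 K)))} ×ˢ Set.univ, torusPairIntegrandC m K
            (fun g => whittakerCoeff ν₀ (unipotentTateDomain (m + 1) K) (adeleAddChar K)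
              (invQuot (AdelicGroupData.gl (m + 1) K) (Φ i))
              (glDiagonal (m + 1) (AdeleRing (𝓞 K) K) (Fin.snoc τ 1) * glCorner (AdeleRing (𝓞 K) K) (Nat.le_succ m) g))
            (fun g => star (whittakerCoeff ν₀' (unipotentTateDomain m K) (adeleAddChar K)
              (invQuot (AdelicGroupData.gl m K) (Φ' i)) (glDiagonal m (AdeleRing (𝓞 K) K) τ * g)))
            (fun _ => (1 : ℝ)) (s - 1 / 2) p ∂(νA.prod νK) := by
      rw [Finset.mul_sum]
      refine Finset.sum_congr rfl fun i _ => ?_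
      ring
    rw [hre]
    linear_combination ((C : ℂ) * torusWeightC m K (s - 1 / 2) τ *
      partialPairL (↑S₀ : Set (HeightOneSpectrum (𝓞 K))) α₀ β₀ s) * hloc

/-- **The corner heart** (registered as `stub_corner_entire_quotient`), from the stubs `stub_jacquet_corner`,
`stub_corner_local_control` and `stub_corner_global_translate`. [cite: CogdellAnalyticTheory2004, Thm. 4.2 and §4.2] -/
theorem stub_corner_entire_quotient :
    ∀ {m : ℕ} {K : Type} [Field K] [NumberField K]
      {μ : Measure (gl (m + 1) K).automorphicQuotient} [(gl (m + 1) K).IsAutomorphicMeasure μ]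
      {μ' : Measure (gl m K).automorphicQuotient} [(gl m K).IsAutomorphicMeasure μ']
      (_hm : 0 < m) (P : CuspidalAutomorphicRepGL (m + 1) K μ) (P' : CuspidalAutomorphicRepGL m K μ')
      (S₀ : Finset (HeightOneSpectrum (𝓞 K)))
      (_hS₀ : ∀ v ∉ S₀, IsUnramifiedAt P.1 v ∧ IsUnramifiedAt P'.1 v)
      {α₀ β₀ : SatakeFamily K} (_hα₀ : IsSatakeFamilyOf P (↑S₀ : Set (HeightOneSpectrum (𝓞 K))) α₀)
      (_hβ₀ : IsSatakeFamilyOf P' (↑S₀ : Set (HeightOneSpectrum (𝓞 K))) β₀) (s₀ : ℂ),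
      ∃ (x₀ : ℝ) (J A : ℂ → ℂ), Differentiable ℂ J ∧ Differentiable ℂ A ∧ A s₀ ≠ 0 ∧
        ∀ s : ℂ, x₀ < s.re → J s = A s * partialPairL (↑S₀ : Set (HeightOneSpectrum (𝓞 K))) α₀ β₀ s :=
  corner_entire_quotient_of_local_control stub_jacquet_corner

/-! ## THE GAP ROAD (lead c6, skeleton v19): Mœglin–Waldspurger (i)(a) for `m + 2 ≤ n` by the
Jacquet–Piatetski-Shapiro–Shalika integrals WITH Cogdell's projector `ℙⁿ_m` — the `GL_n × GL_m` analogue of the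
corner road (Cogdell (2004), §2.2.1–§2.3, Thm. 2.1–2.2, §4.2; JPSS (1983), §2)

After unfolding, `I(s; φ, φ') = ∫_{N_m(𝔸)\GL_m(𝔸)} W_φ(diag(h, 1_{n-m})) W'_{φ'}(h) |det h|^{s-(n-m)/2} dh`: in the
tree's torus coordinates this is the Bochner pair integral of
`torusPairIntegrandC m K (W_Φ ∘ ι) (star W_{Φ'}) 1 s'`, `ι = glCorner (m ≤ n)`, `s' = s - (n-m)/2`. Everything
below is stated at the TORUS parameter `s'` (so the local Euler factor at a good place is
`P_{α_v, β_v}(q_v^{-(s' + (n-m)/2)})⁻¹` and `L^{S'}` is evaluated at `s' + (n-m)/2`). Two named inputs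
(`stub_gap_entire_fact` = Cogdell (2004) Thm. 2.1, analytic clause; `stub_gap_arch_fact` = Jacquet (2009)
Thm. 2.1/2.6 + Prop. 12.5 with Cogdell §4.2, archimedean `K_∞`-finite entire-ratio control), five
engineering stubs (`stub_gap_abs_convergence`, `stub_gap_euler_limit`, `stub_gap_unitBox_productForm`,
`stub_gap_local_single_datum`, `stub_gap_local_control`) and the lead's `stub_gap_global_translate`; the gap
heart `gap_entire_quotient_of_local_control` and `stub_MW_gap` are DERIVED here. -/

section GapRoad

/-! ### The two named facts of the gap road: the archimedean one is the Literature fact of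
`ArchRankinSelbergGapTestVector` (with its pair integral `archGapPairIntegralCplx`), the analytic clause the Literature
fact of `JPSSUnfoldedPairIntegralEntire` (both landed by wave 1 of lead c6) -/

/-- **STUB (named fact F-arch, XL)** — the archimedean gap fact at every rank: the Literature named fact
`JacquetShalika1990_archRankinSelbergGap_entireRatio` (`ArchRankinSelbergGapTestVector`, landed p133384; Jacquet (2009)
Thm. 2.1 (i)(ii), Thm. 2.6 (i), Prop. 12.5 (ii), §12.3; Cogdell (2004) Thm. 3.5, §4.2; nothing is proved for any rank). -/
theorem stub_gap_arch_fact : ∀ (n m : ℕ) (K : Type) [Field K] [NumberField K], JacquetShalika1990_archRankinSelbergGap_entireRatio n m K := by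
  sorry

/-- **STUB (named fact F-an, global-analytic)** — the analytic clause at every rank: the Literature named fact
`Cogdell2004_unfoldedPairIntegral_entire` (`JPSSUnfoldedPairIntegralEntire`, landed p133584; Cogdell (2004), Thm. 2.1, analytic
clause in unfolded form; NOT provable from the tree's existence-only reduction theory — see that file's docstring). -/
theorem stub_gap_entire_fact : ∀ (n m : ℕ) (K : Type) [Field K] [NumberField K], Cogdell2004_unfoldedPairIntegral_entire n m K := by
  sorry

/-! ### Engineering stubs of the gap road -/

/-- **G-Ac (LANDED p134397, `GapAbsConvergence.stub_gap_abs_convergence`; part `GapAbsMajorant` p133377) — one-factor absolute convergence of the unfolded `GL_n × GL_m` integral** (Cogdell (2004),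
§2.2 "absolutely convergent for `Re s ≫ 0` by the gauge estimates"; JPSS (1983), §2): the `GL_n × GL_m` version of
`corner_abs_convergence_one` — for an `A_G`-invariant honest cusp form `φ` on `GL_n(𝔸_K)` (`0 < m < n`) there is
`σ₀` with `∫_{(𝔸ˣ)ᵐ × K} |W_φ(diag(diag(a)k, 1_{n-m}))| |det a|^σ δ_B(a)⁻¹ < ∞` for all `σ ≥ σ₀`
(`W = whittakerDepth 0`). Road: the `GL_n` Whittaker majorant at the corner torus points — support
`|a_{l,v}|_v ≤ R_v` (`valued_lt_of_whittakerDepth_zero_ne_zero` chained down from the root `(m-1, m)`, whose second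
entry is `1`) and archimedean decay `‖W_φ(ι(diag(a)k))‖ ≤ C ∏_{l,w} min(1, ‖a_{l,w}‖^{-M})`
(`exists_norm_whittakerDepth_zero_mul_pow_le`), as `CornerAbsMajorant` with the Iwasawa data
`diag(append a_f 1) diag(k_f, 1)`; then `CornerAbsTorusMajorant.stub_corner_torus_majorant` (torus side, reusable
verbatim) and the lintegral bound of `CornerAbsConvergence`. -/
theorem stub_gap_abs_convergence :
    ∀ {n m : ℕ} {K : Type} [Field K] [NumberField K]
      [MeasurableSpace (AdeleRing (𝓞 K) K)] [BorelSpace (AdeleRing (𝓞 K) K)] (_hm : 0 < m) (hmn : m < n)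
      (νA : Measure (Fin m → ideleGroup K)) [IsHaarMeasure νA]
      (νK : Measure ↥(maximalCompactAdelic m K)) [IsHaarMeasure νK]
      {φ : GL (Fin n) (AdeleRing (𝓞 K) K) → ℂ},
      IsCuspFormGL n K (isCompact_glFiniteIntegralLevel_holds n K) φ →
      (∀ z ∈ (AdelicGroupData.gl n K).center', ∀ g : (AdelicGroupData.gl n K).Adelic, φ (z * g) = φ g) →
      ∃ σ₀ : ℝ, ∀ σ : ℝ, σ₀ ≤ σ →
        ∫⁻ p, ‖whittakerDepth 0 φ (glCorner (AdeleRing (𝓞 K) K) hmn.le (torusPoint m K p))‖ₑ *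
            ENNReal.ofReal (torusWeight m K σ p.1) ∂(νA.prod νK) < ⊤ :=
  GapAbsConvergence.stub_gap_abs_convergence

/-- **G-EL (LANDED p134811, `GapEulerLimit.stub_gap_euler_limit`; parts `GapPairTranslate` p133314, `GapPairEuler` p134005)
— the Euler factorisation of the unfolded `GL_n × GL_m` integral over ALL good places**
(Jacquet–Shalika (1981), §2; Cogdell (2004), Thm. 2.2 with Thm. 3.3; the unramified computation for `m < n`:
`∫_{N_m\GL_m(F_v)} W(diag(h, 1_{n-m})) W'(h) |det h|^{s-(n-m)/2} dh = L(s, π_v × π'_v)`, Shintani + Cauchy with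
padded partitions — `hasSum_whittakerModel_cornerTorus (m ≤ n)`): the `GL_n × GL_m` version of
`corner_euler_limit` (`CornerPairEuler` + `CornerEulerLimit`). For continuous `W` on `GL_n(𝔸_K)` (`‖W‖`
central-invariant), `W'` on `GL_m(𝔸_K)`, unramified torus data at every `v ∉ S'` with parameters `x_v ∈ ℂⁿ`,
`y_v ∈ ℂᵐ` bounded by `q_v^{1/2}` and enumerating `α_v`, `β_v`, an integrable pair integrand at the torus
parameter `s` (`re s > 1/2`) and `L` the product of the local factors `P_{α_v, β_v}(q_v^{-(s + (n-m)/2)})⁻¹` over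
`v ∉ S'`: `∫ I_s = L · ∫_{B({v ∉ S'}) × K} I_s`. -/
theorem stub_gap_euler_limit :
    ∀ {n m : ℕ} {K : Type} [Field K] [NumberField K]
      [MeasurableSpace (AdeleRing (𝓞 K) K)] [BorelSpace (AdeleRing (𝓞 K) K)] (_hm : 0 < m) (hmn : m < n)
      (νA : Measure (Fin m → ideleGroup K)) [IsHaarMeasure νA]
      (νK : Measure ↥(maximalCompactAdelic m K)) [IsHaarMeasure νK]
      {W : GL (Fin n) (AdeleRing (𝓞 K) K) → ℂ} {W' : GL (Fin m) (AdeleRing (𝓞 K) K) → ℂ},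
      Continuous W → Continuous W' →
      (∀ (z : ideleGroup K) (g : GL (Fin n) (AdeleRing (𝓞 K) K)),
        ‖W (Matrix.GeneralLinearGroup.scalar (Fin n) z * g)‖ = ‖W g‖) →
      ∀ {S' : Set (HeightOneSpectrum (𝓞 K))}
        {ϖ : ∀ v : HeightOneSpectrum (𝓞 K), (v.adicCompletion K)ˣ}
        {x : HeightOneSpectrum (𝓞 K) → Fin n → ℂ} {y : HeightOneSpectrum (𝓞 K) → Fin m → ℂ},
      (∀ v ∉ S', IsTorusUnramifiedAt n K W v (ϖ v) (x v)) →
      (∀ v ∉ S', IsTorusUnramifiedAt m K W' v (ϖ v) (y v)) →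
      (∀ v ∉ S', ∀ i, ‖x v i‖ ≤ (v.residueCard : ℝ) ^ (1 / 2 : ℝ)) →
      (∀ v ∉ S', ∀ a, ‖y v a‖ ≤ (v.residueCard : ℝ) ^ (1 / 2 : ℝ)) →
      ∀ (s : ℂ), 1 / 2 < s.re →
      Integrable (torusPairIntegrandC m K
        (fun g => W (glCorner (AdeleRing (𝓞 K) K) hmn.le g)) W' (fun _ => (1 : ℝ)) s) (νA.prod νK) →
      ∀ {α β : HeightOneSpectrum (𝓞 K) → Multiset ℂ},
      (∀ v ∉ S', (Finset.univ : Finset (Fin n)).val.map (x v) = α v) →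
      (∀ v ∉ S', (Finset.univ : Finset (Fin m)).val.map (y v) = β v) →
      ∀ {L : ℂ}, HasProd (fun u : {v : HeightOneSpectrum (𝓞 K) // v ∉ S'} =>
        ((satakePairPolynomial (α u.1) (β u.1)).eval
          ((u.1.residueCard : ℂ) ^ (-(s + ((n : ℂ) - (m : ℂ)) / 2))))⁻¹) L →
      ∫ p, torusPairIntegrandC m K (fun g => W (glCorner (AdeleRing (𝓞 K) K) hmn.le g)) W'
          (fun _ => (1 : ℝ)) s p ∂(νA.prod νK) =
        L * ∫ p in unitBox {v | v ∉ S'} ×ˢ Set.univ, torusPairIntegrandC m K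
          (fun g => W (glCorner (AdeleRing (𝓞 K) K) hmn.le g)) W' (fun _ => (1 : ℝ)) s p
          ∂(νA.prod νK) :=
  GapEulerLimit.stub_gap_euler_limit

/-- **G-GT (LANDED p134974, `GapGlobalTranslate.stub_gap_global_translate`; parts `GapGlobalTranslatePart1` p133366,
`GapGlobalTranslatePart2` p134002, `GapGlobalTranslateOf` p134895) — the gap global theorem in TRANSLATE form at the
torus parameter**, GRANTED the
analytic clause (F-an): for cuspidal `π` on `GL_n(𝔸_K)`, `σ` on `GL_m(𝔸_K)` (`0 < m < n`) with Satake families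
`α`, `γ` off `S`, HONEST continuous representatives `Φ`, `Φ'` of `sv ∈ π`, `sv' ∈ σ`, right `K(𝔫₀)`-invariant,
`S' ⊇ S` off which `v ∤ 𝔫₀`, torus elements `τ ∈ (𝔸_Kˣ)ᵐ`, `T ∈ (𝔸_Kˣ)ⁿ` with `T_i = τ_i` (`i < m`) and `T`
trivial at the infinite places, each realising at every `v ∉ S'` a diagonal shift of
constant ratio `a_v` with `ψ_{K,v}(a_v ·)` of conductor `𝒪_v`, and enumerations `x`, `y` of `α`, `γ` off `S'`,
there are `x₀` and an ENTIRE `J` with, for `re s > x₀`,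
`J(s) = w_s(τ) · L^{S'}(s + (n-m)/2, α ⊗ γ̄) · ∫_{B({v ∉ S'}) × K} torusPairIntegrandC m K (W_Φ(diag(T) ι ·))
(star W_{Φ'}(diag τ ·)) 1 s`. Road: (F-an) at the pair `(R(D)Φ, Φ')`, `D = diag(1_m, T_m, …, T_{n-1})`
(finite-adelic; `IsCuspFormGL.rightTranslation_gl`), whose unfolded integrand is `W_Φ(ι(ak) D) W̄_{Φ'}(ak)`;
the torus substitution `a ↦ τ a` (`torusPoint_mul`, `torusWeightC_mul`, left invariance of `νA`) and
`ι(τ) D = diag(T)`, `D ι(g) = ι(g) D`; the honest translated unramified data `honest_translate_unramified` at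
`GL_n` (`T = diag T`) and at `GL_m` (`T = diag τ`, `.star`); one-factor absolute convergence
`stub_gap_abs_convergence` at `R(D)Φ` for the integrability; `stub_gap_euler_limit` and `hasProd_partialPairL`. -/
theorem stub_gap_global_translate :
    ∀ {n m : ℕ} {K : Type} [Field K] [NumberField K]
      [MeasurableSpace (AdeleRing (𝓞 K) K)] [BorelSpace (AdeleRing (𝓞 K) K)] (_hm : 0 < m) (hmn : m < n),
      Cogdell2004_unfoldedPairIntegral_entire n m K →
    ∀ (μ : Measure (AdelicGroupData.gl n K).automorphicQuotient)
      [(AdelicGroupData.gl n K).IsAutomorphicMeasure μ]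
      (μ' : Measure (AdelicGroupData.gl m K).automorphicQuotient) [(AdelicGroupData.gl m K).IsAutomorphicMeasure μ']
      (νA : Measure (Fin m → ideleGroup K)) [IsHaarMeasure νA]
      (νK : Measure ↥(maximalCompactAdelic m K)) [IsHaarMeasure νK]
      (ν₀ : Measure ↥(adelicUnipotent n K)) [IsHaarMeasure ν₀]
      (ν₀' : Measure ↥(adelicUnipotent m K)) [IsHaarMeasure ν₀']
      (P : CuspidalAutomorphicRepGL n K μ) (Q : CuspidalAutomorphicRepGL m K μ')
        {S : Set (HeightOneSpectrum (𝓞 K))} {α γ : SatakeFamily K},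
        IsSatakeFamilyOf P S α → IsSatakeFamilyOf Q S γ →
      ∀ {Φ : (AdelicGroupData.gl n K).automorphicQuotient → ℂ}
        {Φ' : (AdelicGroupData.gl m K).automorphicQuotient → ℂ}, Continuous Φ → Continuous Φ' →
      ∀ (sv : P.1.toSubmodule) (sv' : Q.1.toSubmodule),
        (((sv : (AdelicGroupData.gl n K).L2 μ) : (AdelicGroupData.gl n K).automorphicQuotient → ℂ)
          =ᵐ[μ] Φ) →
        (((sv' : (AdelicGroupData.gl m K).L2 μ') : (AdelicGroupData.gl m K).automorphicQuotient → ℂ) =ᵐ[μ'] Φ') →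
        IsCuspFormGL n K (isCompact_glFiniteIntegralLevel_holds n K)
          (invQuot (AdelicGroupData.gl n K) Φ) →
        IsCuspFormGL m K (isCompact_glFiniteIntegralLevel_holds m K) (invQuot (AdelicGroupData.gl m K) Φ') →
      ∀ {𝔫₀ : Ideal (𝓞 K)}, 𝔫₀ ≠ 0 →
        (∀ k ∈ principalCongruenceLevel n K 𝔫₀, ∀ y : GL (Fin n) (AdeleRing (𝓞 K) K),
          invQuot (AdelicGroupData.gl n K) Φ (y * k) = invQuot (AdelicGroupData.gl n K) Φ y) →
        (∀ k ∈ principalCongruenceLevel m K 𝔫₀, ∀ y : GL (Fin m) (AdeleRing (𝓞 K) K),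
          invQuot (AdelicGroupData.gl m K) Φ' (y * k) = invQuot (AdelicGroupData.gl m K) Φ' y) →
      ∀ {S' : Set (HeightOneSpectrum (𝓞 K))}, S ⊆ S' → (∀ v ∉ S', ¬ v.asIdeal ∣ 𝔫₀) →
      ∀ (τ : Fin m → ideleGroup K) (T : Fin n → ideleGroup K),
        (∀ i : Fin m, T (Fin.castLE hmn.le i) = τ i) →
        GLn.toMixed n K (glDiagonal n (AdeleRing (𝓞 K) K) T) = 1 →
        (∀ v ∉ S', ∃ (d : Fin n → (v.adicCompletion K)ˣ) (a : (v.adicCompletion K)ˣ),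
          localComponent v (glDiagonal n (AdeleRing (𝓞 K) K) T) =
            diagonalGL (Fin n) (v.adicCompletion K) d ∧
          (∀ i j : Fin n, (i : ℕ) + 1 = j →
            (d i : v.adicCompletion K) * ((d j)⁻¹ : (v.adicCompletion K)ˣ) = a) ∧
          (∀ c ∈ 𝒪[v.adicCompletion K], (adeleAddChar K).adicComponent v (a * c) = 1) ∧
          ∀ ϖ : v.adicCompletion K, Valued.v ϖ = WithZero.exp (-1 : ℤ) →
            ∃ c ∈ 𝒪[v.adicCompletion K], (adeleAddChar K).adicComponent v (a * (ϖ⁻¹ * c)) ≠ 1) →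
        (∀ v ∉ S', ∃ (d : Fin m → (v.adicCompletion K)ˣ) (a : (v.adicCompletion K)ˣ),
          localComponent v (glDiagonal m (AdeleRing (𝓞 K) K) τ) =
            diagonalGL (Fin m) (v.adicCompletion K) d ∧
          (∀ i j : Fin m, (i : ℕ) + 1 = j →
            (d i : v.adicCompletion K) * ((d j)⁻¹ : (v.adicCompletion K)ˣ) = a) ∧
          (∀ c ∈ 𝒪[v.adicCompletion K], (adeleAddChar K).adicComponent v (a * c) = 1) ∧
          ∀ ϖ : v.adicCompletion K, Valued.v ϖ = WithZero.exp (-1 : ℤ) →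
            ∃ c ∈ 𝒪[v.adicCompletion K], (adeleAddChar K).adicComponent v (a * (ϖ⁻¹ * c)) ≠ 1) →
      ∀ {x : HeightOneSpectrum (𝓞 K) → Fin n → ℂ} {y : HeightOneSpectrum (𝓞 K) → Fin m → ℂ},
        (∀ v ∉ S', (Finset.univ : Finset (Fin n)).val.map (x v) = α v) →
        (∀ v ∉ S', (Finset.univ : Finset (Fin m)).val.map (y v) = γ v) →
      ∃ (x₀ : ℝ) (J : ℂ → ℂ), Differentiable ℂ J ∧ ∀ s : ℂ, x₀ < s.re →
        J s = torusWeightC m K s τ *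
            (partialPairL S' α (fun v => (γ v).map conj) (s + ((n : ℂ) - (m : ℂ)) / 2) *
              ∫ p in unitBox {v | v ∉ S'} ×ˢ Set.univ, torusPairIntegrandC m K
                (fun g => whittakerCoeff ν₀ (unipotentTateDomain n K) (adeleAddChar K)
                  (invQuot (AdelicGroupData.gl n K) Φ)
                  (glDiagonal n (AdeleRing (𝓞 K) K) T * glCorner (AdeleRing (𝓞 K) K) hmn.le g))
                (fun g => star (whittakerCoeff ν₀' (unipotentTateDomain m K) (adeleAddChar K)
                  (invQuot (AdelicGroupData.gl m K) Φ') (glDiagonal m (AdeleRing (𝓞 K) K) τ * g)))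
                (fun _ => (1 : ℝ)) s p ∂(νA.prod νK)) :=
  GapGlobalTranslate.stub_gap_global_translate

/-- **G-PF (LANDED p134574, `GapUnitBoxProductForm.stub_gap_unitBox_productForm`; parts `GapUnitBoxLocalValue` p133470,
`GapUnitBoxPeel` p134006) — support collapse and product form of the translated `GL_n × GL_m` pair integrand on the unit
box**: the `GL_n × GL_m` version of `corner_unitBox_productForm` (`CornerUnitBoxLocalValue` + `CornerUnitBoxPeel` +
`CornerUnitBoxProductForm`; JPSS (1983), §2, (2.7); Cogdell (2004), §4.1). Abstractly in two functions: `W` on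
`GL_n(𝔸_K)` left `ψ`-equivariant, central up to modulus one, right `K_f(𝔫)`-invariant with the primes of `𝔫` in
`Bad`, spread at every `v ∈ Bad` (`IsSpreadWhittakerAt` for `Fin n`; along `diag(h, 1_{n-m})` the rows `> m` are
standard basis vectors, so the thin condition holds at every depth); `W'` on `GL_m(𝔸_K)` left `ψ`-equivariant,
right `K_f(𝔫)`- and `K_v(𝔭^M)`-invariant; torus shifts `τ ∈ (𝔸_Kˣ)ᵐ`, `T ∈ (𝔸_Kˣ)ⁿ` trivial at `Bad`;
`I(s) = torusPairIntegrandC m K (W(diag(T) ι ·)) (W̄'(diag τ ·)) 1 s` (`ι = glCorner (m ≤ n)`). (i)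
`∫_{B({v ∉ Bad}) × K} I = ∫_{B(all) × K} I`; (ii) on `B(all) × K`, `I(p) = F((diag a k)_f) · W(diag(T) (ι(diag a k)_∞, 1))
· conj W'(diag τ ((diag a k)_∞, 1)) · |det a|_∞^s δ⁻¹` with `F ∈ {0, 1}`, `F(1) = 1`, `F` right `K_f(𝔪)`-invariant
on `GL_m(𝒪̂)` for some `𝔪 ≠ 0`. -/
theorem stub_gap_unitBox_productForm :
    ∀ {n m : ℕ} {K : Type} [Field K] [NumberField K]
      [MeasurableSpace (AdeleRing (𝓞 K) K)] [BorelSpace (AdeleRing (𝓞 K) K)] (_hm : 0 < m) (hmn : m < n)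
      (W : GL (Fin n) (AdeleRing (𝓞 K) K) → ℂ) (W' : GL (Fin m) (AdeleRing (𝓞 K) K) → ℂ)
      (_ : ∀ (u : ↥(adelicUnipotent n K)) (g : GL (Fin n) (AdeleRing (𝓞 K) K)),
        W ((u : GL (Fin n) (AdeleRing (𝓞 K) K)) * g) = whittakerCharFun (adeleAddChar K) u * W g)
      (_ : ∀ (u : ↥(adelicUnipotent m K)) (g : GL (Fin m) (AdeleRing (𝓞 K) K)),
        W' ((u : GL (Fin m) (AdeleRing (𝓞 K) K)) * g) = whittakerCharFun (adeleAddChar K) u * W' g)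
      (_ : ∀ (z : ideleGroup K) (g : GL (Fin n) (AdeleRing (𝓞 K) K)),
        ‖W (Matrix.GeneralLinearGroup.scalar (Fin n) z * g)‖ = ‖W g‖)
      {𝔫 : Ideal (𝓞 K)} (_ : 𝔫 ≠ 0)
      (_ : ∀ u ∈ finitePrincipalCongruenceLevel n K 𝔫, ∀ g : GL (Fin n) (AdeleRing (𝓞 K) K),
        W (g * GLn.ofFinite n K u) = W g)
      (_ : ∀ u ∈ finitePrincipalCongruenceLevel m K 𝔫, ∀ g : GL (Fin m) (AdeleRing (𝓞 K) K),
        W' (g * GLn.ofFinite m K u) = W' g)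
      {Bad : Finset (HeightOneSpectrum (𝓞 K))} (_ : ∀ w : HeightOneSpectrum (𝓞 K), w.asIdeal ∣ 𝔫 → w ∈ Bad)
      (τ : Fin m → ideleGroup K) (_ : ∀ v ∈ Bad, localComponent v (glDiagonal m (AdeleRing (𝓞 K) K) τ) = 1)
      (T : Fin n → ideleGroup K) (_ : ∀ v ∈ Bad, localComponent v (glDiagonal n (AdeleRing (𝓞 K) K) T) = 1)
      (_ : ∀ v ∈ Bad, ∃ (tv : Fin n → (v.adicCompletion K)ˣ) (M c₀ : ℤ),
          IsSpreadWhittakerAt v (adeleAddChar K) tv M W ∧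
          (∃ y : v.adicCompletion K, Valued.v y ≤ exp (1 - c₀) ∧ (adeleAddChar K).adicComponent v y ≠ 1) ∧ 1 ≤ M ∧
          (∀ i j : Fin n, i ≤ j → Valued.v (tv j : v.adicCompletion K) ≤ Valued.v (tv i : v.adicCompletion K)) ∧
          (∀ i j : Fin n, (i : ℕ) + 1 = j →
            exp (M - c₀) * Valued.v (tv j : v.adicCompletion K) ≤ Valued.v (tv i : v.adicCompletion K)) ∧
          ∀ κ ∈ valuedCongruenceSubgroup (Fin m) (exp (-M)), ∀ g : GL (Fin m) (AdeleRing (𝓞 K) K),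
            W' (g * GLn.ofLocal m K v κ) = W' g)
      (νA : Measure (Fin m → ideleGroup K)) (νK : Measure ↥(maximalCompactAdelic m K)),
    let I : ℂ → (Fin m → ideleGroup K) × ↥(maximalCompactAdelic m K) → ℂ :=
      fun s => torusPairIntegrandC m K
        (fun g => W (glDiagonal n (AdeleRing (𝓞 K) K) T * glCorner (AdeleRing (𝓞 K) K) hmn.le g))
        (fun g => star W' (glDiagonal m (AdeleRing (𝓞 K) K) τ * g)) (fun _ => (1 : ℝ)) s
    ∃ (𝔪 : Ideal (𝓞 K)) (_ : 𝔪 ≠ 0) (F : GL (Fin m) (FiniteAdeleRing (𝓞 K) K) → ℂ),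
      (∀ g ∈ glFiniteIntegralLevel m K, ∀ u ∈ finitePrincipalCongruenceLevel m K 𝔪, F (g * u) = F g) ∧
      (∀ g, F g = 0 ∨ F g = 1) ∧ F 1 = 1 ∧
      ∀ s : ℂ,
        (∫ p in unitBox {v | v ∉ (↑Bad : Set (HeightOneSpectrum (𝓞 K)))} ×ˢ Set.univ, I s p ∂(νA.prod νK) =
          ∫ p in unitBox (Set.univ : Set (HeightOneSpectrum (𝓞 K))) ×ˢ Set.univ, I s p ∂(νA.prod νK)) ∧
        ∀ p : (Fin m → ideleGroup K) × ↥(maximalCompactAdelic m K),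
          p.1 ∈ unitBox (n := m) (K := K) (Set.univ : Set (HeightOneSpectrum (𝓞 K))) →
          I s p = F (GLn.sndHom m K (torusPoint m K p)) *
            (W (glDiagonal n (AdeleRing (𝓞 K) K) T *
              GLn.ofInfinite n K (glCorner (mixedSpace K) hmn.le (GLn.toMixed m K (torusPoint m K p)))) *
            conj (W' (glDiagonal m (AdeleRing (𝓞 K) K) τ * GLn.ofInfinite m K (GLn.toMixed m K (torusPoint m K p)))) *
            archTorusWeightC m K s (archTorusOfIdele m K p.1)) :=
  GapUnitBoxProductForm.stub_gap_unitBox_productForm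

/-- **G-LSD (LANDED p135055, `GapLocalSingleDatum.stub_gap_local_single_datum`; part `GapLocalSingleDatumOfProductForm` p134160)
— ONE archimedean `GL_n × GL_m` datum realised inside the translated gap box integral**:
the `GL_n × GL_m` version of `corner_local_single_datum` (`CornerLocalSingleDatum`; JPSS (1983), (2.7) at the
finite places of `S₀` by spread data; Cogdell (2004), §4.1, `Ψ = ∏_v Ψ_v`). Given torus shifts `τ ∈ (𝔸_Kˣ)ᵐ`,
`T ∈ (𝔸_Kˣ)ⁿ` trivial at `S₀ ∪ ∞`, pure tensors `S₁ ∈ π_f` (`π` cuspidal on `GL_n`), `S₁' ∈ σ_f` (`σ` cuspidal on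
`GL_m`) of levels `K_f(𝔫P)`, `K_f(𝔫Q)` with `𝔫P 𝔫Q` supported on `S₀`, and `K_∞`-finite Gårding vectors `e`, `e'`
of the archimedean components `τP`, `τQ`, there are a level `𝔫` supported on `S₀`, HONEST continuous
representatives `Φ`, `Φ'` of vectors `sv ∈ π`, `sv' ∈ σ`, right `K(𝔫)`-invariant, and `κ > 0` with, for every `s`,
`∫_{B({v ∉ S₀}) × K} W_Φ(diag(T) ι ·) W̄_{Φ'}(diag τ ·) |det|^s δ⁻¹ = κ · Ψ^{(n,m)}_∞(s; Φ_λ(diag(T)_f S₁),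
Φ_λ'(diag(τ)_f S₁'), e, e')` (`archGapPairIntegralCplx` against the image Haar measures). Assembly as the corner
version with the gap product form `stub_gap_unitBox_productForm`, `TranslateArchValue.stub_translate_arch_value` at
the points `diag(T) ι(y)`, the spread datum for `π`, level-weight fixing, coset averaging, honesty by
`isAutomorphicForm_invQuot_smoothedForm_of_fixed` + `isCuspFormGL_invQuot_of_mem_cuspidalSubspace_holds`. -/
theorem stub_gap_local_single_datum :
    ∀ {n m : ℕ} {K : Type} [Field K] [NumberField K]
      {μ : Measure (gl n K).automorphicQuotient} [(gl n K).IsAutomorphicMeasure μ]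
      {μ' : Measure (gl m K).automorphicQuotient} [(gl m K).IsAutomorphicMeasure μ']
      [MeasurableSpace (AdeleRing (𝓞 K) K)] [BorelSpace (AdeleRing (𝓞 K) K)] (_hm : 0 < m) (hmn : m < n)
      (hcpt : isCompact_glFiniteIntegralLevel n K) (hcpt' : isCompact_glFiniteIntegralLevel m K)
      (P : CuspidalAutomorphicRepGL n K μ) (Q : CuspidalAutomorphicRepGL m K μ')
      (νA : Measure (Fin m → ideleGroup K)) [IsHaarMeasure νA]
      (νK : Measure ↥(maximalCompactAdelic m K)) [IsHaarMeasure νK]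
      (ν₀ : Measure ↥(adelicUnipotent n K)) [IsHaarMeasure ν₀]
      (ν₀' : Measure ↥(adelicUnipotent m K)) [IsHaarMeasure ν₀']
      {E : Type} [NormedAddCommGroup E] [InnerProductSpace ℂ E] [CompleteSpace E]
      {τP : ContRepresentation ℂ (archGroupGL n K).carrier E} (hτPc : τP.IsStronglyContinuous)
      {E' : Type} [NormedAddCommGroup E'] [InnerProductSpace ℂ E'] [CompleteSpace E']
      {τQ : ContRepresentation ℂ (archGroupGL m K).carrier E'} (hτQc : τQ.IsStronglyContinuous)
      (S₀ : Finset (HeightOneSpectrum (𝓞 K))) (τ : Fin m → ideleGroup K) (T : Fin n → ideleGroup K)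
      (_ : GLn.toMixed m K (glDiagonal m (AdeleRing (𝓞 K) K) τ) = 1)
      (_ : ∀ v ∈ S₀, localComponent v (glDiagonal m (AdeleRing (𝓞 K) K) τ) = 1)
      (_ : GLn.toMixed n K (glDiagonal n (AdeleRing (𝓞 K) K) T) = 1)
      (_ : ∀ v ∈ S₀, localComponent v (glDiagonal n (AdeleRing (𝓞 K) K) T) = 1)
      {𝔫P 𝔫Q : Ideal (𝓞 K)} (_ : 𝔫P ≠ 0) (_ : 𝔫Q ≠ 0)
      (_ : ∀ w ∉ S₀, ¬ w.asIdeal ∣ 𝔫P * 𝔫Q)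
      (S₁ : multiplicityModule hcpt τP P.1)
      (_ : (S₁ : E →L[ℂ] (gl n K).L2 μ) ∈ archIntertwinersLevel hcpt τP P.1 (finitePrincipalCongruenceLevel n K 𝔫P))
      (S₁' : multiplicityModule hcpt' τQ Q.1)
      (_ : (S₁' : E' →L[ℂ] (gl m K).L2 μ') ∈ archIntertwinersLevel hcpt' τQ Q.1 (finitePrincipalCongruenceLevel m K 𝔫Q))
      (e : archGardingSpace hcpt τP) (e' : archGardingSpace hcpt' τQ)
      (_ : FiniteDimensional ℂ (Submodule.span ℂ (Set.range
        fun κ : ↥(Kinf n K) => τP (toArch hcpt κ.1) e.1)))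
      (_ : FiniteDimensional ℂ (Submodule.span ℂ (Set.range
        fun κ : ↥(Kinf m K) => τQ (toArch hcpt' κ.1) e'.1)))
      [MeasurableSpace (GL (Fin m) (mixedSpace K))] [BorelSpace (GL (Fin m) (mixedSpace K))],
    ∃ (𝔫 : Ideal (𝓞 K)) (_ : 𝔫 ≠ 0) (_ : ∀ w ∉ S₀, ¬ w.asIdeal ∣ 𝔫)
      (Φ : (gl n K).automorphicQuotient → ℂ) (Φ' : (gl m K).automorphicQuotient → ℂ)
      (sv : P.1.toSubmodule) (sv' : Q.1.toSubmodule) (_ : Continuous Φ) (_ : Continuous Φ')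
      (_ : ((sv : (gl n K).L2 μ) : _ → ℂ) =ᵐ[μ] Φ)
      (_ : ((sv' : (gl m K).L2 μ') : _ → ℂ) =ᵐ[μ'] Φ')
      (_ : IsCuspFormGL n K hcpt (invQuot (gl n K) Φ))
      (_ : IsCuspFormGL m K hcpt' (invQuot (gl m K) Φ'))
      (_ : ∀ u ∈ principalCongruenceLevel n K 𝔫, ∀ y, invQuot (gl n K) Φ (y * u :) = invQuot (gl n K) Φ y)
      (_ : ∀ u ∈ principalCongruenceLevel m K 𝔫, ∀ y, invQuot (gl m K) Φ' (y * u :) = invQuot (gl m K) Φ' y)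
      (κ : ℝ), 0 < κ ∧
      ∀ s,
        ∫ p in unitBox {v | v ∉ (↑S₀ : Set _)} ×ˢ univ,
          torusPairIntegrandC m K
            (fun g => whittakerCoeff ν₀ (unipotentTateDomain n K) (adeleAddChar K) (invQuot (gl n K) Φ)
              (glDiagonal n (AdeleRing (𝓞 K) K) T * glCorner (AdeleRing (𝓞 K) K) hmn.le g))
            (fun g => star (whittakerCoeff ν₀' (unipotentTateDomain m K) (adeleAddChar K) (invQuot (gl m K) Φ')
              (glDiagonal m (AdeleRing (𝓞 K) K) τ * g)))
            (fun _ => 1) s p ∂(νA.prod νK) =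
        (κ : ℂ) * archGapPairIntegralCplx hmn.le hcpt hcpt' τP hτPc τQ hτQc
          (transferMap (whittakerFunctional ν₀ (continuous_adeleAddChar K) (ContRepresentation.Equiv.refl P.1.toContRep)) hτPc
            (finComponentRep hcpt τP P.1 (GLn.sndHom n K (glDiagonal n (AdeleRing (𝓞 K) K) T)) S₁))
          (transferMap (whittakerFunctional ν₀' (continuous_adeleAddChar K) (ContRepresentation.Equiv.refl Q.1.toContRep)) hτQc
            (finComponentRep hcpt' τQ Q.1 (GLn.sndHom m K (glDiagonal m (AdeleRing (𝓞 K) K) τ)) S₁')) e e'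
          ((νA.restrict (unitBox univ)).map (archTorusOfIdele m K)) (νK.map (kinfOfMaximalCompact m K)) s :=
  GapLocalSingleDatum.stub_gap_local_single_datum

/-- **G-LC (LANDED p135084, `GapLocalControlAsm.stub_gap_local_control`; part `GapArchFactorData` p133733) — the gap LOCAL
control at a prescribed point `s₀`**: the `GL_n × GL_m` version of
`corner_local_control` (`CornerArchFactorData` + `CornerLocalSingleDatum` + `CornerLocalControlAsm`), GRANTED the
archimedean gap fact (hypothesis). For a finite `S₀` off which `π` (`GL_n`) and `σ` (`GL_m`) are unramified and any
`s₀` there are torus shifts `τ ∈ (𝔸_Kˣ)ᵐ`, `T ∈ (𝔸_Kˣ)ⁿ` with `T_i = τ_i` (`i < m`), `T` trivial at `∞`, both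
correcting the conductor of Tate's character off `S₀` (constant ratio `a_v` in EVERY simple root), finitely many
data `(c_i, Φ_i, Φ'_i)` — HONEST continuous representatives of vectors of `π`, `σ` with ONE level `𝔫₀` supported on
`S₀` — and ENTIRE `Λ`, `h` with `h(s₀) ≠ 0` and, on a right half-plane,
`Λ(s) · Σ_i c_i · ∫_{B({v ∉ S₀}) × K} W_{Φ_i}(diag(T) ι ·) W̄_{Φ'_i}(diag τ ·) |det|^s δ⁻¹ = h(s)` (`Λ = (c^s ∏Γ)⁻¹`
entire by `Complex.differentiable_one_div_Gamma`; the finite-place part is a non-zero constant by the gap product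
form; the ideles `T`, `τ` exist because Tate's character is unramified almost everywhere). -/
theorem stub_gap_local_control :
    (∀ (N M : ℕ) (K : Type) [Field K] [NumberField K], JacquetShalika1990_archRankinSelbergGap_entireRatio N M K) →
    ∀ {n m : ℕ} {K : Type} [Field K] [NumberField K]
      {μ : Measure (AdelicGroupData.gl n K).automorphicQuotient}
      [(AdelicGroupData.gl n K).IsAutomorphicMeasure μ]
      {μ' : Measure (AdelicGroupData.gl m K).automorphicQuotient} [(AdelicGroupData.gl m K).IsAutomorphicMeasure μ']
      [MeasurableSpace (AdeleRing (𝓞 K) K)] [BorelSpace (AdeleRing (𝓞 K) K)] (_hm : 0 < m) (hmn : m < n)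
      (νA : Measure (Fin m → ideleGroup K)) [IsHaarMeasure νA]
      (νK : Measure ↥(maximalCompactAdelic m K)) [IsHaarMeasure νK]
      (ν₀ : Measure ↥(adelicUnipotent n K)) [IsHaarMeasure ν₀]
      (ν₀' : Measure ↥(adelicUnipotent m K)) [IsHaarMeasure ν₀']
      (P : CuspidalAutomorphicRepGL n K μ) (Q : CuspidalAutomorphicRepGL m K μ')
      (S₀ : Finset (HeightOneSpectrum (𝓞 K))), (∀ v ∉ S₀, IsUnramifiedAt P.1 v ∧ IsUnramifiedAt Q.1 v) →
      ∀ (s₀ : ℂ),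
      ∃ (τ : Fin m → ideleGroup K) (T : Fin n → ideleGroup K),
      (∀ i : Fin m, T (Fin.castLE hmn.le i) = τ i) ∧
      GLn.toMixed n K (glDiagonal n (AdeleRing (𝓞 K) K) T) = 1 ∧
      (∀ v ∉ S₀, ∃ (d : Fin n → (v.adicCompletion K)ˣ) (a : (v.adicCompletion K)ˣ),
        localComponent v (glDiagonal n (AdeleRing (𝓞 K) K) T) =
          diagonalGL (Fin n) (v.adicCompletion K) d ∧
        (∀ i j : Fin n, (i : ℕ) + 1 = j →
          (d i : v.adicCompletion K) * ((d j)⁻¹ : (v.adicCompletion K)ˣ) = a) ∧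
        (∀ c ∈ 𝒪[v.adicCompletion K], (adeleAddChar K).adicComponent v (a * c) = 1) ∧
        ∀ ϖ : v.adicCompletion K, Valued.v ϖ = WithZero.exp (-1 : ℤ) →
          ∃ c ∈ 𝒪[v.adicCompletion K], (adeleAddChar K).adicComponent v (a * (ϖ⁻¹ * c)) ≠ 1) ∧
      (∀ v ∉ S₀, ∃ (d : Fin m → (v.adicCompletion K)ˣ) (a : (v.adicCompletion K)ˣ),
        localComponent v (glDiagonal m (AdeleRing (𝓞 K) K) τ) =
          diagonalGL (Fin m) (v.adicCompletion K) d ∧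
        (∀ i j : Fin m, (i : ℕ) + 1 = j →
          (d i : v.adicCompletion K) * ((d j)⁻¹ : (v.adicCompletion K)ˣ) = a) ∧
        (∀ c ∈ 𝒪[v.adicCompletion K], (adeleAddChar K).adicComponent v (a * c) = 1) ∧
        ∀ ϖ : v.adicCompletion K, Valued.v ϖ = WithZero.exp (-1 : ℤ) →
          ∃ c ∈ 𝒪[v.adicCompletion K], (adeleAddChar K).adicComponent v (a * (ϖ⁻¹ * c)) ≠ 1) ∧
      ∃ (k : ℕ) (c : Fin k → ℂ)
        (Φ : Fin k → (AdelicGroupData.gl n K).automorphicQuotient → ℂ)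
        (Φ' : Fin k → (AdelicGroupData.gl m K).automorphicQuotient → ℂ)
        (sv : Fin k → P.1.toSubmodule) (sv' : Fin k → Q.1.toSubmodule) (𝔫₀ : Ideal (𝓞 K)),
      𝔫₀ ≠ 0 ∧ (∀ w : HeightOneSpectrum (𝓞 K), w.asIdeal ∣ 𝔫₀ → w ∈ S₀) ∧
      (∀ i, Continuous (Φ i)) ∧ (∀ i, Continuous (Φ' i)) ∧
      (∀ i, (((sv i : (AdelicGroupData.gl n K).L2 μ) : (AdelicGroupData.gl n K).automorphicQuotient → ℂ)
        =ᵐ[μ] Φ i)) ∧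
      (∀ i, (((sv' i : (AdelicGroupData.gl m K).L2 μ') : (AdelicGroupData.gl m K).automorphicQuotient → ℂ)
        =ᵐ[μ'] Φ' i)) ∧
      (∀ i, IsCuspFormGL n K (isCompact_glFiniteIntegralLevel_holds n K)
        (invQuot (AdelicGroupData.gl n K) (Φ i))) ∧
      (∀ i, IsCuspFormGL m K (isCompact_glFiniteIntegralLevel_holds m K) (invQuot (AdelicGroupData.gl m K) (Φ' i))) ∧
      (∀ i, ∀ u ∈ principalCongruenceLevel n K 𝔫₀, ∀ y : GL (Fin n) (AdeleRing (𝓞 K) K),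
        invQuot (AdelicGroupData.gl n K) (Φ i) (y * u) = invQuot (AdelicGroupData.gl n K) (Φ i) y) ∧
      (∀ i, ∀ u ∈ principalCongruenceLevel m K 𝔫₀, ∀ y : GL (Fin m) (AdeleRing (𝓞 K) K),
        invQuot (AdelicGroupData.gl m K) (Φ' i) (y * u) = invQuot (AdelicGroupData.gl m K) (Φ' i) y) ∧
      ∃ (Λ h : ℂ → ℂ) (x₁ : ℝ), Differentiable ℂ Λ ∧ Differentiable ℂ h ∧ h s₀ ≠ 0 ∧ ∀ s : ℂ, x₁ < s.re →
        Λ s * ∑ i, c i * ∫ p in unitBox {v | v ∉ (↑S₀ : Set (HeightOneSpectrum (𝓞 K)))} ×ˢ Set.univ,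
          torusPairIntegrandC m K
            (fun g => whittakerCoeff ν₀ (unipotentTateDomain n K) (adeleAddChar K)
              (invQuot (AdelicGroupData.gl n K) (Φ i))
              (glDiagonal n (AdeleRing (𝓞 K) K) T * glCorner (AdeleRing (𝓞 K) K) hmn.le g))
            (fun g => star (whittakerCoeff ν₀' (unipotentTateDomain m K) (adeleAddChar K)
              (invQuot (AdelicGroupData.gl m K) (Φ' i)) (glDiagonal m (AdeleRing (𝓞 K) K) τ * g)))
            (fun _ => (1 : ℝ)) s p ∂(νA.prod νK) = h s :=
  GapLocalControlAsm.stub_gap_local_control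

/-! ### The gap heart DERIVED: the entire quotient representation from the global translate theorem (G-GT) and
the local control (G-LC), granted the two named facts -/

/-- **The gap heart.** For cuspidal `π` on `GL_n`, `σ` on `GL_m` (`0 < m < n`), a finite `S₀` off which both are
unramified, Satake families `α₀`, `β₀` off `S₀` and any `s₀` (shift `h = (n-m)/2`): with the local control at
`(π, σ̄, S₀)` targeted at `s₀ - h` (`τ`, `T`, data `(c_i, Φ_i, Φ'_i)`, `Λ`, `hh`) and the entire functions `J_i` of
the global translate theorem at `(π, σ̄, γ = β̄₀)`, `J := Λ(s - h) Σ_i c_i J_i(s - h)` is entire,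
`A := w_{s-h}(τ) · hh(s - h)` is entire with `A(s₀) ≠ 0` (`torusWeightC_ne_zero`), and `J = A · L^{S₀}(s, α₀ ⊗ β₀)`
on a right half-plane (`IsSatakeFamilyOf.conj`, `isUnramifiedAt_conj_iff`, `multiset_map_conj_map_conj`,
`exists_univ_val_map_eq`). [cite: CogdellAnalyticTheory2004, Thm. 4.2 and §4.2] -/
theorem gap_entire_quotient_of_local_control
    (hA : ∀ (N M : ℕ) (K : Type) [Field K] [NumberField K], JacquetShalika1990_archRankinSelbergGap_entireRatio N M K)
    (hE : ∀ (N M : ℕ) (K : Type) [Field K] [NumberField K], Cogdell2004_unfoldedPairIntegral_entire N M K) :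
    ∀ {n m : ℕ} {K : Type} [Field K] [NumberField K]
      {μ : Measure (gl n K).automorphicQuotient} [(gl n K).IsAutomorphicMeasure μ]
      {μ' : Measure (gl m K).automorphicQuotient} [(gl m K).IsAutomorphicMeasure μ']
      (_hm : 0 < m) (hmn : m < n) (P : CuspidalAutomorphicRepGL n K μ) (P' : CuspidalAutomorphicRepGL m K μ')
      (S₀ : Finset (HeightOneSpectrum (𝓞 K)))
      (_hS₀ : ∀ v ∉ S₀, IsUnramifiedAt P.1 v ∧ IsUnramifiedAt P'.1 v)
      {α₀ β₀ : SatakeFamily K} (_hα₀ : IsSatakeFamilyOf P (↑S₀ : Set (HeightOneSpectrum (𝓞 K))) α₀)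
      (_hβ₀ : IsSatakeFamilyOf P' (↑S₀ : Set (HeightOneSpectrum (𝓞 K))) β₀) (s₀ : ℂ),
      ∃ (x₀ : ℝ) (J A : ℂ → ℂ), Differentiable ℂ J ∧ Differentiable ℂ A ∧ A s₀ ≠ 0 ∧
        ∀ s : ℂ, x₀ < s.re → J s = A s * partialPairL (↑S₀ : Set (HeightOneSpectrum (𝓞 K))) α₀ β₀ s := by
  intro n m K _ _ μ _ μ' _ hm hmn P P' S₀ hS₀ α₀ β₀ hα₀ hβ₀ s₀
  classical
  -- instances, as in `corner_entire_quotient_of_local_control`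
  haveI : T2Space (AdeleRing (𝓞 K) K) := t2Space_adeleRing K
  letI : MeasurableSpace (AdeleRing (𝓞 K) K) := borel _
  haveI : BorelSpace (AdeleRing (𝓞 K) K) := ⟨rfl⟩
  haveI := borelSpace_ideleGroup K
  haveI := locallyCompactSpace_ideleGroup K
  haveI := secondCountableTopology_ideleGroup K
  haveI := secondCountableTopology_adeleRing K
  haveI := locallyCompactSpace_adeleRing' K
  haveI : T2Space (GL (Fin n) (AdeleRing (𝓞 K) K)) := t2Space_gl n K
  haveI : T2Space (GL (Fin m) (AdeleRing (𝓞 K) K)) := t2Space_gl m K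
  haveI : LocallyCompactSpace (GL (Fin n) (AdeleRing (𝓞 K) K)) :=
    AdelicGroupData.locallyCompactSpace_generalLinearGroup_adeleRing K (Fin n)
  haveI : LocallyCompactSpace (GL (Fin m) (AdeleRing (𝓞 K) K)) :=
    AdelicGroupData.locallyCompactSpace_generalLinearGroup_adeleRing K (Fin m)
  haveI := secondCountableTopology_generalLinearGroup_adeleRing K (Fin n)
  haveI := secondCountableTopology_generalLinearGroup_adeleRing K (Fin m)
  haveI : CompactSpace ↥(maximalCompactAdelic m K) :=
    isCompact_iff_compactSpace.1 (isCompact_maximalCompactAdelic m K)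
  haveI : LocallyCompactSpace ↥(adelicUnipotent n K) := (isClosed_adelicUnipotent n K).locallyCompactSpace
  haveI : LocallyCompactSpace ↥(adelicUnipotent m K) := (isClosed_adelicUnipotent m K).locallyCompactSpace
  -- Haar measures
  obtain ⟨νA, hνA⟩ : ∃ ν : Measure (Fin m → ideleGroup K), IsHaarMeasure ν := ⟨Measure.haar, inferInstance⟩
  obtain ⟨νK, hνK⟩ : ∃ ν : Measure ↥(maximalCompactAdelic m K), IsHaarMeasure ν := ⟨Measure.haar, inferInstance⟩
  obtain ⟨ν₀, hν₀⟩ : ∃ ν : Measure ↥(adelicUnipotent n K), IsHaarMeasure ν := ⟨Measure.haar, inferInstance⟩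
  obtain ⟨ν₀', hν₀'⟩ : ∃ ν : Measure ↥(adelicUnipotent m K), IsHaarMeasure ν := ⟨Measure.haar, inferInstance⟩
  -- `π` and `σ̄` are unramified off `S₀`
  have hU : ∀ v ∉ S₀, IsUnramifiedAt P.1 v ∧ IsUnramifiedAt P'.conj.1 v := fun v hv =>
    ⟨(hS₀ v hv).1, isUnramifiedAt_conj_iff.2 (hS₀ v hv).2⟩
  -- the shift between the torus parameter and the `L`-parameter
  set sh : ℂ := ((n : ℂ) - (m : ℂ)) / 2 with hsh
  -- the local control datum at `(π, σ̄, S₀)`, targeted at `s₀ - sh`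
  obtain ⟨τ, T, hTτ, hTinf, hTψ, hτψ, k, c, Φ, Φ', sv, sv', 𝔫₀, h𝔫₀, h𝔫₀S, hΦc, hΦ'c, hae, hae', hΦcusp, hΦ'cusp,
    hΦU, hΦ'U, Λ, hh, x₁, hΛ, hhh, hh0, hΛsum⟩ :=
    stub_gap_local_control hA hm hmn νA νK ν₀ ν₀' P P'.conj S₀ hU (s₀ - sh)
  have hS' : ∀ v ∉ (↑S₀ : Set (HeightOneSpectrum (𝓞 K))), ¬ v.asIdeal ∣ 𝔫₀ := fun v hv h =>
    hv (Finset.mem_coe.2 (h𝔫₀S v h))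
  -- enumerations of the Satake parameters of `π`, `σ̄` off `S₀`
  have hexx : ∀ v : HeightOneSpectrum (𝓞 K), ∃ x : Fin n → ℂ, v ∉ (↑S₀ : Set (HeightOneSpectrum (𝓞 K))) →
      (Finset.univ : Finset (Fin n)).val.map x = α₀ v := by
    intro v
    by_cases hv : v ∉ (↑S₀ : Set (HeightOneSpectrum (𝓞 K)))
    · obtain ⟨x, hx⟩ := exists_univ_val_map_eq (hα₀.card_eq hv)
      exact ⟨x, fun _ => hx⟩
    · exact ⟨fun _ => 0, fun h => absurd h hv⟩
  have hexy : ∀ v : HeightOneSpectrum (𝓞 K), ∃ y : Fin m → ℂ, v ∉ (↑S₀ : Set (HeightOneSpectrum (𝓞 K))) →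
      (Finset.univ : Finset (Fin m)).val.map y = (β₀ v).map conj := by
    intro v
    by_cases hv : v ∉ (↑S₀ : Set (HeightOneSpectrum (𝓞 K)))
    · obtain ⟨y, hy⟩ := exists_univ_val_map_eq (R := ℂ) (m := m) (α := (β₀ v).map conj)
        (by rw [Multiset.card_map]; exact hβ₀.card_eq hv)
      exact ⟨y, fun _ => hy⟩
    · exact ⟨fun _ => 0, fun h => absurd h hv⟩
  choose x hx using hexx
  choose y hy using hexy
  have hββ : (fun v => ((β₀ v).map conj).map conj) = β₀ := funext fun v => multiset_map_conj_map_conj _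
  -- the translate identities, one entire function for each datum
  choose xf J hJd hJ using fun i : Fin k =>
    stub_gap_global_translate hm hmn (hE n m K) μ μ' νA νK ν₀ ν₀' P P'.conj hα₀ hβ₀.conj (hΦc i) (hΦ'c i)
      (sv i) (sv' i) (hae i) (hae' i) (hΦcusp i) (hΦ'cusp i) h𝔫₀ (hΦU i) (hΦ'U i) Set.Subset.rfl hS' τ T hTτ
      hTinf (fun v hv => hTψ v fun h => hv (Finset.mem_coe.2 h)) (fun v hv => hτψ v fun h => hv (Finset.mem_coe.2 h))
      hx hy
  -- the entire functions
  set xmax : ℝ := (∑ i, |xf i|) + |x₁| + |sh.re| + 1 with hxmax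
  refine ⟨xmax, fun s => Λ (s - sh) * ∑ i, c i * J i (s - sh),
    fun s => torusWeightC m K (s - sh) τ * hh (s - sh), ?_, ?_, ?_, ?_⟩
  · -- `J` is entire
    have hΛ' : Differentiable ℂ fun s : ℂ => Λ (s - sh) := hΛ.comp (differentiable_id.sub_const _)
    have hI : ∀ i, Differentiable ℂ fun s : ℂ => J i (s - sh) := fun i =>
      (hJd i).comp (differentiable_id.sub_const _)
    have hsum : Differentiable ℂ fun s => ∑ i, c i * J i (s - sh) := by
      have h : Differentiable ℂ (∑ i, fun s => c i * J i (s - sh)) :=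
        Differentiable.sum fun i _ => (hI i).const_mul (c i)
      convert h using 1
      funext s
      simp only [Finset.sum_apply]
    exact hΛ'.mul hsum
  · -- `A` is entire
    exact ((differentiable_torusWeightC τ).comp (differentiable_id.sub_const _)).mul
      (hhh.comp (differentiable_id.sub_const _))
  · -- `A s₀ ≠ 0`
    exact mul_ne_zero (torusWeightC_ne_zero _ τ) hh0
  · -- the identity on `re s > xmax`
    intro s hs
    have hshre : (s - sh).re = s.re - sh.re := by simp only [Complex.sub_re]
    have habs : ∀ i, xf i < (s - sh).re := fun i => by
      have h1 : xf i ≤ |xf i| := le_abs_self _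
      have h2 : |xf i| ≤ ∑ j, |xf j| := Finset.single_le_sum (fun j _ => abs_nonneg (xf j)) (Finset.mem_univ i)
      have h3 : (0 : ℝ) ≤ |x₁| := abs_nonneg _
      have h4 : sh.re ≤ |sh.re| := le_abs_self _
      rw [hshre]; linarith
    have hs₁ : x₁ < (s - sh).re := by
      have h1 : x₁ ≤ |x₁| := le_abs_self _
      have h2 : (0 : ℝ) ≤ ∑ j, |xf j| := Finset.sum_nonneg fun j _ => abs_nonneg (xf j)
      have h4 : sh.re ≤ |sh.re| := le_abs_self _
      rw [hshre]; linarith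
    have hloc := hΛsum (s - sh) hs₁
    have e1 : s - sh + sh = s := sub_add_cancel s sh
    -- each entire function on the half-plane
    have hterm : ∀ i, J i (s - sh) =
        torusWeightC m K (s - sh) τ *
          (partialPairL (↑S₀ : Set (HeightOneSpectrum (𝓞 K))) α₀ β₀ s *
            ∫ p in unitBox {v | v ∉ (↑S₀ : Set (HeightOneSpectrum (𝓞 K)))} ×ˢ Set.univ, torusPairIntegrandC m K
              (fun g => whittakerCoeff ν₀ (unipotentTateDomain n K) (adeleAddChar K)
                (invQuot (AdelicGroupData.gl n K) (Φ i))
                (glDiagonal n (AdeleRing (𝓞 K) K) T * glCorner (AdeleRing (𝓞 K) K) hmn.le g))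
              (fun g => star (whittakerCoeff ν₀' (unipotentTateDomain m K) (adeleAddChar K)
                (invQuot (AdelicGroupData.gl m K) (Φ' i)) (glDiagonal m (AdeleRing (𝓞 K) K) τ * g)))
              (fun _ => (1 : ℝ)) (s - sh) p ∂(νA.prod νK)) := by
      intro i
      have h := hJ i (s - sh) (habs i)
      rw [hββ, e1] at h
      exact h
    simp_rw [hterm]
    -- `Λ · ∑ c_i (w L Ψ_i) = w L · (Λ ∑ c_i Ψ_i) = w L hh`
    have hre : ∑ i, c i * (torusWeightC m K (s - sh) τ *
        (partialPairL (↑S₀ : Set (HeightOneSpectrum (𝓞 K))) α₀ β₀ s *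
          ∫ p in unitBox {v | v ∉ (↑S₀ : Set (HeightOneSpectrum (𝓞 K)))} ×ˢ Set.univ, torusPairIntegrandC m K
            (fun g => whittakerCoeff ν₀ (unipotentTateDomain n K) (adeleAddChar K)
              (invQuot (AdelicGroupData.gl n K) (Φ i))
              (glDiagonal n (AdeleRing (𝓞 K) K) T * glCorner (AdeleRing (𝓞 K) K) hmn.le g))
            (fun g => star (whittakerCoeff ν₀' (unipotentTateDomain m K) (adeleAddChar K)
              (invQuot (AdelicGroupData.gl m K) (Φ' i)) (glDiagonal m (AdeleRing (𝓞 K) K) τ * g)))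
            (fun _ => (1 : ℝ)) (s - sh) p ∂(νA.prod νK))) =
      torusWeightC m K (s - sh) τ * partialPairL (↑S₀ : Set (HeightOneSpectrum (𝓞 K))) α₀ β₀ s *
        ∑ i, c i * ∫ p in unitBox {v | v ∉ (↑S₀ : Set (HeightOneSpectrum (𝓞 K)))} ×ˢ Set.univ, torusPairIntegrandC m K
            (fun g => whittakerCoeff ν₀ (unipotentTateDomain n K) (adeleAddChar K)
              (invQuot (AdelicGroupData.gl n K) (Φ i))
              (glDiagonal n (AdeleRing (𝓞 K) K) T * glCorner (AdeleRing (𝓞 K) K) hmn.le g))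
            (fun g => star (whittakerCoeff ν₀' (unipotentTateDomain m K) (adeleAddChar K)
              (invQuot (AdelicGroupData.gl m K) (Φ' i)) (glDiagonal m (AdeleRing (𝓞 K) K) τ * g)))
            (fun _ => (1 : ℝ)) (s - sh) p ∂(νA.prod νK) := by
      rw [Finset.mul_sum]
      refine Finset.sum_congr rfl fun i _ => ?_
      ring
    rw [hre]
    linear_combination (torusWeightC m K (s - sh) τ *
      partialPairL (↑S₀ : Set (HeightOneSpectrum (𝓞 K))) α₀ β₀ s) * hloc

/-! ### Mœglin–Waldspurger (i)(a) for `m + 2 ≤ n` from the gap heart -/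

/-- **The gap case `m + 2 ≤ n` of Mœglin–Waldspurger (i)(a)** from `gap_entire_quotient_of_local_control` (granted
the two named facts): the ramified set `S₀` of the pair with its canonical Satake families
(`exists_isSatakeFamilyOf_pair_ramified`), the abscissa made uniform (`x₀ := 1`) by the identity theorem
(`eqOn_halfPlane_of_eqOn_right`, `differentiableOn_partialPairL_of_isSatakeFamilyOf`), then
`MoeglinWaldspurger1989_partialPairL_entire_of_rank_ne_of_entire_quotients`. [cite: CogdellAnalyticTheory2004, Thm. 4.2 and §4.2] -/
theorem partialPairL_entire_of_gap {n m : ℕ} {K : Type} [Field K] [NumberField K]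
    {μ : Measure (gl n K).automorphicQuotient} [(gl n K).IsAutomorphicMeasure μ]
    {μ' : Measure (gl m K).automorphicQuotient} [(gl m K).IsAutomorphicMeasure μ'] (hgap : m + 2 ≤ n) :
    MoeglinWaldspurger1989_partialPairL_entire_of_rank_ne (n := n) (m := m) (K := K) (μ := μ)
      (μ' := μ') := by
  refine MoeglinWaldspurger1989_partialPairL_entire_of_rank_ne_of_entire_quotients fun _hnm _hn hm P P' => ?_
  classical
  have hmn : m < n := by omega
  -- the ramified set of the pair and the canonical Satake families off it
  obtain ⟨α₀, β₀, hα₀', hβ₀'⟩ := exists_isSatakeFamilyOf_pair_ramified P P'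
  have hS₀f : {v : HeightOneSpectrum (𝓞 K) | ¬ IsUnramifiedAt P.1 v ∨ ¬ IsUnramifiedAt P'.1 v}.Finite :=
    finite_setOf_not_isUnramifiedAt_or P P'
  obtain ⟨S₀, hcoe⟩ : ∃ S₀ : Finset (HeightOneSpectrum (𝓞 K)),
      (↑S₀ : Set (HeightOneSpectrum (𝓞 K))) = {v | ¬ IsUnramifiedAt P.1 v ∨ ¬ IsUnramifiedAt P'.1 v} :=
    ⟨hS₀f.toFinset, hS₀f.coe_toFinset⟩
  have hmemS₀ : ∀ v : HeightOneSpectrum (𝓞 K), v ∈ S₀ ↔ ¬ IsUnramifiedAt P.1 v ∨ ¬ IsUnramifiedAt P'.1 v :=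
    fun v => by rw [← Finset.mem_coe, hcoe, Set.mem_setOf_eq]
  have hα₀ : IsSatakeFamilyOf P (↑S₀ : Set (HeightOneSpectrum (𝓞 K))) α₀ := hα₀'.mono hcoe.symm.subset
  have hβ₀ : IsSatakeFamilyOf P' (↑S₀ : Set (HeightOneSpectrum (𝓞 K))) β₀ := hβ₀'.mono hcoe.symm.subset
  have hram : ∀ v ∈ (↑S₀ : Set (HeightOneSpectrum (𝓞 K))), ¬ IsUnramifiedAt P.1 v ∨ ¬ IsUnramifiedAt P'.1 v :=
    fun v hv => (hmemS₀ v).1 (Finset.mem_coe.1 hv)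
  have hU : ∀ v ∉ S₀, IsUnramifiedAt P.1 v ∧ IsUnramifiedAt P'.1 v := fun v hv =>
    ⟨of_not_not fun h => hv ((hmemS₀ v).2 (Or.inl h)), of_not_not fun h => hv ((hmemS₀ v).2 (Or.inr h))⟩
  refine ⟨↑S₀, α₀, β₀, hram, hα₀, hβ₀, 1, fun s₀ => ?_⟩
  obtain ⟨x₀, J, A, hJ, hA, hA0, hJA⟩ :=
    gap_entire_quotient_of_local_control stub_gap_arch_fact stub_gap_entire_fact hm hmn P P' S₀ hU hα₀ hβ₀ s₀
  refine ⟨J, A, hJ, hA, hA0, ?_⟩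
  have hL := differentiableOn_partialPairL_of_isSatakeFamilyOf P P' hα₀ hβ₀
  have hAL : DifferentiableOn ℂ (fun s => A s * partialPairL (↑S₀ : Set (HeightOneSpectrum (𝓞 K))) α₀ β₀ s)
      {s : ℂ | 1 < s.re} := hA.differentiableOn.mul hL
  exact eqOn_halfPlane_of_eqOn_right hJ hAL (le_max_right x₀ 1)
    fun s hs => hJA s (lt_of_le_of_lt (le_max_left _ _) hs)

/-- **Mœglin–Waldspurger (i)(a) for `m + 2 ≤ n`** (registered as `stub_MW_gap`; formerly the crux-sized input of
v14–v18) — now DERIVED from the gap road: `partialPairL_entire_of_gap`, i.e. from the named facts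
`stub_gap_arch_fact`, `stub_gap_entire_fact` and the stubs `stub_gap_global_translate`, `stub_gap_local_control`
(the latter resting on `stub_gap_abs_convergence`, `stub_gap_euler_limit`, `stub_gap_unitBox_productForm`,
`stub_gap_local_single_datum` once their files land). [cite: CogdellAnalyticTheory2004, Thm. 4.2] -/
theorem stub_MW_gap :
    ∀ {n m : ℕ} {K : Type} [Field K] [NumberField K]
      {μ : Measure (gl n K).automorphicQuotient} [(gl n K).IsAutomorphicMeasure μ]
      {μ' : Measure (gl m K).automorphicQuotient} [(gl m K).IsAutomorphicMeasure μ'],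
      m + 2 ≤ n →
      MoeglinWaldspurger1989_partialPairL_entire_of_rank_ne (n := n) (m := m) (K := K) (μ := μ)
        (μ' := μ') := by
  intro n m K _ _ μ _ μ' _ hgap
  exact partialPairL_entire_of_gap hgap

end GapRoad


/-! ## Mœglin–Waldspurger (i)(a) at `n = m + 1` from the corner heart (bookkeeping proved in the tree) -/

/-- **The corner case `n = m + 1` of Mœglin–Waldspurger (i)(a)** from `stub_corner_entire_quotient`:
the ramified set `S₀` of the pair with its canonical Satake families
(`exists_isSatakeFamilyOf_pair_ramified`), the abscissa made uniform (`x₀ := 1`) by the identity theorem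
(`eqOn_halfPlane_of_eqOn_right`, `differentiableOn_partialPairL_of_isSatakeFamilyOf`), then
`MoeglinWaldspurger1989_partialPairL_entire_of_rank_ne_of_entire_quotients`. [cite: CogdellAnalyticTheory2004, Thm. 4.2 and §4.2] -/
theorem partialPairL_entire_of_rank_succ {m : ℕ} {K : Type} [Field K] [NumberField K]
    {μ : Measure (gl (m + 1) K).automorphicQuotient} [(gl (m + 1) K).IsAutomorphicMeasure μ]
    {μ' : Measure (gl m K).automorphicQuotient} [(gl m K).IsAutomorphicMeasure μ'] :
    MoeglinWaldspurger1989_partialPairL_entire_of_rank_ne (n := m + 1) (m := m) (K := K) (μ := μ)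
      (μ' := μ') := by
  refine MoeglinWaldspurger1989_partialPairL_entire_of_rank_ne_of_entire_quotients fun _hnm _hn hm P P' => ?_
  classical
  -- the ramified set of the pair and the canonical Satake families off it
  obtain ⟨α₀, β₀, hα₀', hβ₀'⟩ := exists_isSatakeFamilyOf_pair_ramified P P'
  have hS₀f : {v : HeightOneSpectrum (𝓞 K) | ¬ IsUnramifiedAt P.1 v ∨ ¬ IsUnramifiedAt P'.1 v}.Finite :=
    finite_setOf_not_isUnramifiedAt_or P P'
  obtain ⟨S₀, hcoe⟩ : ∃ S₀ : Finset (HeightOneSpectrum (𝓞 K)),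
      (↑S₀ : Set (HeightOneSpectrum (𝓞 K))) = {v | ¬ IsUnramifiedAt P.1 v ∨ ¬ IsUnramifiedAt P'.1 v} :=
    ⟨hS₀f.toFinset, hS₀f.coe_toFinset⟩
  have hmemS₀ : ∀ v : HeightOneSpectrum (𝓞 K), v ∈ S₀ ↔ ¬ IsUnramifiedAt P.1 v ∨ ¬ IsUnramifiedAt P'.1 v :=
    fun v => by rw [← Finset.mem_coe, hcoe, Set.mem_setOf_eq]
  have hα₀ : IsSatakeFamilyOf P (↑S₀ : Set (HeightOneSpectrum (𝓞 K))) α₀ := hα₀'.mono hcoe.symm.subset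
  have hβ₀ : IsSatakeFamilyOf P' (↑S₀ : Set (HeightOneSpectrum (𝓞 K))) β₀ := hβ₀'.mono hcoe.symm.subset
  have hram : ∀ v ∈ (↑S₀ : Set (HeightOneSpectrum (𝓞 K))), ¬ IsUnramifiedAt P.1 v ∨ ¬ IsUnramifiedAt P'.1 v :=
    fun v hv => (hmemS₀ v).1 (Finset.mem_coe.1 hv)
  have hU : ∀ v ∉ S₀, IsUnramifiedAt P.1 v ∧ IsUnramifiedAt P'.1 v := fun v hv =>
    ⟨of_not_not fun h => hv ((hmemS₀ v).2 (Or.inl h)), of_not_not fun h => hv ((hmemS₀ v).2 (Or.inr h))⟩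
  refine ⟨↑S₀, α₀, β₀, hram, hα₀, hβ₀, 1, fun s₀ => ?_⟩
  obtain ⟨x₀, J, A, hJ, hA, hA0, hJA⟩ := stub_corner_entire_quotient hm P P' S₀ hU hα₀ hβ₀ s₀
  refine ⟨J, A, hJ, hA, hA0, ?_⟩
  -- uniform abscissa: `J = A · L^{S₀}` on `re s > max x₀ 1`, hence on `re s > 1` by the identity theorem
  have hL := differentiableOn_partialPairL_of_isSatakeFamilyOf P P' hα₀ hβ₀
  have hAL : DifferentiableOn ℂ (fun s => A s * partialPairL (↑S₀ : Set (HeightOneSpectrum (𝓞 K))) α₀ β₀ s)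
      {s : ℂ | 1 < s.re} := hA.differentiableOn.mul hL
  exact eqOn_halfPlane_of_eqOn_right hJ hAL (le_max_right x₀ 1)
    fun s hs => hJA s (lt_of_le_of_lt (le_max_left _ _) hs)

/-! ## The three leaves, DERIVED from the stubs by the tree's proved reductions -/

/-- **Leaf hA** — Mœglin–Waldspurger (i)(a) at all ranks: `m = 1` / `n = 1` by the LANDED standard-`L`
slices (`StandardEntire.stub_standard_entire_of_ssv Ssv.stub_ssv`), `n = m + 1` / `m = n + 1` by the corner
road (`partialPairL_entire_of_rank_succ` and `…_of_swap`), `|n - m| ≥ 2` by `stub_MW_gap` (and `…_of_swap`). -/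
theorem partialPairL_entire_of_rank_ne_of_stubs {n m : ℕ} {K : Type} [Field K] [NumberField K]
    {μ : Measure (gl n K).automorphicQuotient} [(gl n K).IsAutomorphicMeasure μ]
    {μ' : Measure (gl m K).automorphicQuotient} [(gl m K).IsAutomorphicMeasure μ'] :
    MoeglinWaldspurger1989_partialPairL_entire_of_rank_ne (n := n) (m := m) (K := K) (μ := μ)
      (μ' := μ') := by
  intro hnm hn hm P P' S hS α β hα hβ
  rcases Nat.lt_or_ge m 2 with hm2 | hm2
  · obtain rfl : m = 1 := by omega
    exact MoeglinWaldspurger1989_partialPairL_entire_of_rank_ne_gl_one_of_standard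
      (fun Q _ hS' _ hγ => StandardEntire.stub_standard_entire_of_ssv Ssv.stub_ssv (by omega) Q hS' hγ)
      hnm hn hm P P' hS hα hβ
  rcases Nat.lt_or_ge n 2 with hn2 | hn2
  · obtain rfl : n = 1 := by omega
    exact MoeglinWaldspurger1989_partialPairL_entire_of_rank_ne_of_swap
      (MoeglinWaldspurger1989_partialPairL_entire_of_rank_ne_gl_one_of_standard
        (fun Q _ hS' _ hγ => StandardEntire.stub_standard_entire_of_ssv Ssv.stub_ssv (by omega) Q hS' hγ))
      hnm hn hm P P' hS hα hβ
  rcases lt_or_gt_of_ne hnm with hlt | hgt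
  · -- `n < m`: swap to `(m, n)` with `n < m`
    refine MoeglinWaldspurger1989_partialPairL_entire_of_rank_ne_of_swap ?_ hnm hn hm P P' hS hα hβ
    rcases Nat.lt_or_ge m (n + 2) with h1 | h1
    · obtain rfl : m = n + 1 := by omega
      exact partialPairL_entire_of_rank_succ
    · exact stub_MW_gap h1
  · rcases Nat.lt_or_ge n (m + 2) with h1 | h1
    · obtain rfl : n = m + 1 := by omega
      exact partialPairL_entire_of_rank_succ hnm hn hm P P' hS hα hβ
    · exact stub_MW_gap h1 hnm hn hm P P' hS hα hβ

/-- **Leaf hC** — Mœglin–Waldspurger (ii) from LOCAL★ through C2 (landed), granted `stub_humphriesJo`. -/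
theorem partialPairL_of_eq_conj_of_stubs {n : ℕ} {K : Type} [Field K] [NumberField K]
    {μ : Measure (gl n K).automorphicQuotient} [(gl n K).IsAutomorphicMeasure μ] :
    MoeglinWaldspurger1989_partialPairL_of_eq_conj (n := n) (K := K) (μ := μ) :=
  PairLBoundaryJSOfHumphriesJo.partialPairL_of_eq_conj_of_humphriesJo stub_humphriesJo

/-- **Leaf hB** — the orthogonal-pair continuation from LOCAL★ through C1 (landed), granted `stub_humphriesJo`. -/
theorem partialPairL_entire_of_isOrtho_of_stubs {n : ℕ} {K : Type} [Field K] [NumberField K]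
    {μ : Measure (gl n K).automorphicQuotient} [(gl n K).IsAutomorphicMeasure μ]
    (hn : 0 < n) (P P' : CuspidalAutomorphicRepGL n K μ)
    (hor : P.1.toSubmodule ⟂ P'.conj.1.toSubmodule)
    {S : Set (HeightOneSpectrum (𝓞 K))} (hS : S.Finite) {α β : SatakeFamily K}
    (hα : IsSatakeFamilyOf P S α) (hβ : IsSatakeFamilyOf P' S β) :
    ∃ g : ℂ → ℂ, Differentiable ℂ g ∧ ∀ s : ℂ, 1 < s.re → g s = partialPairL S α β s :=
  PairLBoundaryJSOfHumphriesJo.partialPairL_entire_of_isOrtho_of_humphriesJo stub_humphriesJo hn P P' hor hS hα hβ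

/-! ## Composition -/

/-- **The crux from the stubs.** `PairLBoundaryJS` (Arthur–Clozel (2.2) for Borel–Jacquet data, all
ranks) from the stubs through the three leaves, by the tree's
`PairLBoundaryJS_of_moeglinWaldspurger_of_isOrtho`. -/
theorem PairLBoundaryJS_of :
    Summit.Langlands.Langlands.Theses.IrreducibilityBySelfDuality.PairLBoundaryJS :=
  PairLBoundaryJS_of_moeglinWaldspurger_of_isOrtho partialPairL_entire_of_rank_ne_of_stubs
    partialPairL_of_eq_conj_of_stubs partialPairL_entire_of_isOrtho_of_stubs

end Summit.Langlands.Langlands.Theorems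

end
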